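import Literature.NumberTheory.LFunctions.Zhang2022.Section9Ded97
import Literature.NumberTheory.LFunctions.Zhang2022.Section8ShiftPerturbation
import HarnessLib

/-!
# Zhang (2022) §9: the substitution `x = Pᶻ` at the actual shifts — `Z22:§9.u006` (c-reading) DISCHARGED

Y. Zhang, *Discrete mean estimates and the Landau–Siegel zero*, arXiv:2211.02515v1 (2022)
[Zhang2022LandauSiegel] — **an unrefereed manuscript under adjudication; nothing here asserts anything about
its Theorems 1–2 or about Landau–Siegel zeros.** Campaign cell `siegel-zhang` (D-0069), discharge seat d17,
cone leaf C23 (`Skeleton.Ded97`), continuing `Section9Ded97`.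

The step (Zhang §9 p. 52, tex L2626): "This yields, by substituting `x = Pᶻ`,
`(2α)⁻¹S₁(𝐚₁₂,𝐚₂₂) + 2α⁻¹S₂(𝐚₁₂,𝐚₂₂) + (3/(2α))S₃(𝐚₁₂,𝐚₂₂) = 𝔞(|ι₃|²b₃₃ + ι₃ῑ₄b₃₄ + ι₄ῑ₃b₄₃ + |ι₄|²b₄₄) + o(1)`",
typed as `Section9Statements.Ded9u006c : Step9u005 → Step9u006c` (the c-reading: (9.5)–(9.6) with the
prefactor `1/((0.5)(0.498)π)` which the substitution actually produces; tree `prefactor_95_96`).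

PROVED here: `ded9u006c_holds : Ded9u006c c'` (theorem-only; 0 new definitions, 0 facts). The proof is the
honest version of the substitution: the four-integral form `int9cov_j` is the tree's `S812g` at the scales
`(log P₂, log P₃) = ((0.5 − 10𝓛^{−7.9})𝓛⁹, 0.498𝓛⁹)` (`int9cov_eq_S812g`), which `S812g_eq_zform` turns into
the `z`-form with the ACTUAL profiles `𝔣_{jμ}(Pᶻ), 𝔤_{jμ}(Pᶻ)` and long exponent `θ₂ = log P₂/𝓛⁹`; the
main-order identity is the tree's `weighted_sum_S911_main` (main-value profiles, exponent `1/2`); the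
difference is controlled by

* the shift perturbations `𝔣_{jμ}(Pᶻ) − 𝔣𝔣_{jμ}(z), 𝔤_{jμ}(Pᶻ) − 𝔤𝔥_{jμ}(z) = O_{c′}(𝓛⁻⁸)` — d19's
  `Section8ShiftPerturbation.frakf_rpow_estimate / frakg_rpow_estimate`;
* explicit size and Lipschitz bounds of the profiles on `z ∈ [0,1]` (`norm_frakf_le_gen`, `norm_frakg_le_gen`,
  `frakf_lipschitz`, `frakg_lipschitz`; chord bound `‖e^{ix} − 1‖ ≤ |x|`);
* the generic `z`-form perturbation lemmas `zform_diag_perturb`, `zform_cross_perturb`, `Zform_sub_Zform_le` (private)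
  (change of the long exponent `θ₂ → 1/2`, `1/2 − θ₂ = 10𝓛^{−7.9}`);
* `𝔞 ≤ 360000𝓛⁴` (`Section9Discharge.frakA_le_log_pow_four`), so that `𝔞·O(𝓛⁻³) = o(1)`.

Consequences recorded: `eval97c_of_step9u004r : Eq91 → Prop71 → Step9u004r → Eval97c` and
`eval97c_of_ded9u004 : Step9u001 → Ded9u004 → (Eq91 → Prop71 → Lemma82 → Lemma84 → Eval97c)` — i.e. the
c-reading of (9.7) now follows in the kernel from the banked inputs of `Skeleton.Ded97`, the exact expansion
`Z22:§9.u001`, and the ONE remaining typed inference `Ded9u004` ("in a way similar to the proof of (8.12)",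
the §8 passage (8.10)–(8.11): `λ₀ⱼ(n) = φ(n)²/n² + O(α₁)`, the mean value of `|χ(n)|φ(n)/n²` "[T, 1.2.12]",
partial summation — shared with the §8 chain).

## References

* Y. Zhang, arXiv:2211.02515v1 (2022), §9 pp. 51–52 (tex L2586–L2669); §8 pp. 48–49 ((8.11)–(8.18));
  §2 (2.10), (2.13), (2.21), (2.22), (2.31). [cite: Zhang2022LandauSiegel, §9]
-/

noncomputable section

open Complex Real ComplexConjugate

namespace Literature.NumberTheory.LFunctions.Zhang2022.Section9Discharge

open Skeleton Section9Statements


/-! ## `Z22:§9.u006` (c-reading): "This yields, by substituting `x = Pᶻ`" — generic integral estimates -/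

section ZformGeneric

/-- Norm of the real coefficient `1/(θ²Λ)` cast to `ℂ`, for `θ ≥ 1/4`: at most `16/Λ`. [folklore] -/
private theorem norm_coeff_sq_le {θ Λ : ℝ} (hΛ : 0 < Λ) (hθ : 1 / 4 ≤ θ) :
    ‖(((1 / (θ ^ 2 * Λ)) : ℝ) : ℂ)‖ ≤ 16 / Λ := by
  have hθ0 : 0 < θ := by linarith
  rw [Complex.norm_real, Real.norm_eq_abs, abs_of_pos (by positivity), div_le_div_iff₀ (by positivity) hΛ]
  nlinarith [mul_pos hθ0 hΛ]

/-- Norm of `1/(θθ'Λ)` cast to `ℂ`, for `θ, θ' ≥ 1/4`: at most `16/Λ`. [folklore] -/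
private theorem norm_coeff_mul_le {θ θ' Λ : ℝ} (hΛ : 0 < Λ) (hθ : 1 / 4 ≤ θ) (hθ' : 1 / 4 ≤ θ') :
    ‖(((1 / (θ * θ' * Λ)) : ℝ) : ℂ)‖ ≤ 16 / Λ := by
  have hθ0 : 0 < θ := by linarith
  have hθ0' : 0 < θ' := by linarith
  rw [Complex.norm_real, Real.norm_eq_abs, abs_of_pos (by positivity), div_le_div_iff₀ (by positivity) hΛ]
  nlinarith [mul_pos hθ0 hΛ, mul_pos (mul_pos hθ0 hθ0') hΛ, mul_nonneg (by linarith : (0:ℝ) ≤ θ - 1/4) hθ0'.le]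

/-- `|1/(θ²Λ) − 1/(θ₀²Λ)| ≤ 512(θ₀ − θ)/Λ` for `1/4 ≤ θ ≤ θ₀ ≤ 1`. [folklore] -/
private theorem norm_coeff_sq_sub_le {θ θ₀ Λ : ℝ} (hΛ : 0 < Λ) (hθ : 1 / 4 ≤ θ) (hθθ : θ ≤ θ₀)
    (hθ₀ : θ₀ ≤ 1) :
    ‖(((1 / (θ ^ 2 * Λ)) : ℝ) : ℂ) - (((1 / (θ₀ ^ 2 * Λ)) : ℝ) : ℂ)‖ ≤ 512 * (θ₀ - θ) / Λ := by
  have hθ0 : 0 < θ := by linarith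
  have hθ1 : 0 < θ₀ := by linarith
  have h3 : 0 ≤ θ₀ - θ := by linarith
  rw [← Complex.ofReal_sub, Complex.norm_real, Real.norm_eq_abs]
  have e : 1 / (θ ^ 2 * Λ) - 1 / (θ₀ ^ 2 * Λ) = (θ₀ ^ 2 - θ ^ 2) / (θ ^ 2 * θ₀ ^ 2 * Λ) := by
    field_simp
  have hden : 0 < θ ^ 2 * θ₀ ^ 2 * Λ := by positivity
  have hnum : 0 ≤ θ₀ ^ 2 - θ ^ 2 := by nlinarith
  rw [e, abs_div, abs_of_pos hden, abs_of_nonneg hnum, div_le_div_iff₀ hden hΛ]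
  have hq : (1 / 4 : ℝ) ^ 2 ≤ θ ^ 2 := pow_le_pow_left₀ (by norm_num) hθ 2
  have hq0 : (1 / 4 : ℝ) ^ 2 ≤ θ₀ ^ 2 := pow_le_pow_left₀ (by norm_num) (hθ.trans hθθ) 2
  have h2 : (1 / 256 : ℝ) ≤ θ ^ 2 * θ₀ ^ 2 := by nlinarith
  have key : (θ₀ ^ 2 - θ ^ 2) * Λ ≤ 2 * ((θ₀ - θ) * Λ) := by
    rw [show (θ₀ ^ 2 - θ ^ 2) * Λ = (θ₀ + θ) * ((θ₀ - θ) * Λ) by ring]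
    exact mul_le_mul_of_nonneg_right (by linarith) (mul_nonneg h3 hΛ.le)
  have key2 := mul_le_mul_of_nonneg_left h2 (by positivity : (0:ℝ) ≤ 512 * ((θ₀ - θ) * Λ))
  nlinarith [key, key2]

/-- `|1/(θθ_SΛ) − 1/(θ₀θ_SΛ)| ≤ 64(θ₀ − θ)/Λ` for `1/4 ≤ θ ≤ θ₀`, `θ_S ≥ 1/4`. [folklore] -/
private theorem norm_coeff_mul_sub_le {θ θ₀ θS Λ : ℝ} (hΛ : 0 < Λ) (hθ : 1 / 4 ≤ θ) (hθθ : θ ≤ θ₀)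
    (hS : 1 / 4 ≤ θS) :
    ‖(((1 / (θ * θS * Λ)) : ℝ) : ℂ) - (((1 / (θ₀ * θS * Λ)) : ℝ) : ℂ)‖ ≤ 64 * (θ₀ - θ) / Λ := by
  have hθ0 : 0 < θ := by linarith
  have hθ1 : 0 < θ₀ := by linarith
  have hS0 : 0 < θS := by linarith
  have h3 : 0 ≤ θ₀ - θ := by linarith
  rw [← Complex.ofReal_sub, Complex.norm_real, Real.norm_eq_abs]
  have e : 1 / (θ * θS * Λ) - 1 / (θ₀ * θS * Λ) = (θ₀ - θ) / (θ * θ₀ * θS * Λ) := by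
    field_simp
  have hden : 0 < θ * θ₀ * θS * Λ := by positivity
  rw [e, abs_div, abs_of_pos hden, abs_of_nonneg h3, div_le_div_iff₀ hden hΛ]
  have h2 : (1 / 64 : ℝ) ≤ θ * θ₀ * θS := by
    have := mul_le_mul hθ (hθ.trans hθθ) (by norm_num) hθ0.le
    have := mul_le_mul this hS (by norm_num) (by positivity)
    linarith [show (1/4:ℝ) * (1/4) * (1/4) = 1/64 by norm_num]
  have key2 := mul_le_mul_of_nonneg_left h2 (by positivity : (0:ℝ) ≤ 64 * ((θ₀ - θ) * Λ))
  nlinarith [key2, mul_nonneg h3 hΛ.le]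

/-- **Diagonal `z`-form perturbation.** For continuous `φ, ψ : ℝ → ℂ` with `‖φ − ψ‖ ≤ E` on `[0, θ]` and
`‖ψ‖ ≤ B` on `[0, θ₀]`, where `1/4 ≤ θ ≤ θ₀ ≤ 1`, `Λ > 0`:
`‖(θ²Λ)⁻¹∫₀^θ φ − (θ₀²Λ)⁻¹∫₀^{θ₀} ψ‖ ≤ (16E + 528B(θ₀ − θ))/Λ`. [folklore] -/
private theorem zform_diag_perturb {φ ψ : ℝ → ℂ} (hφ : Continuous φ) (hψ : Continuous ψ)
    {θ θ₀ Λ E B : ℝ} (hΛ : 0 < Λ) (hθ : 1 / 4 ≤ θ) (hθθ : θ ≤ θ₀) (hθ₀ : θ₀ ≤ 1) (hE : 0 ≤ E)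
    (hB : 0 ≤ B) (hE' : ∀ z, 0 ≤ z → z ≤ θ → ‖φ z - ψ z‖ ≤ E)
    (hB' : ∀ z, 0 ≤ z → z ≤ θ₀ → ‖ψ z‖ ≤ B) :
    ‖(((1 / (θ ^ 2 * Λ)) : ℝ) : ℂ) * (∫ z in (0:ℝ)..θ, φ z) -
        (((1 / (θ₀ ^ 2 * Λ)) : ℝ) : ℂ) * (∫ z in (0:ℝ)..θ₀, ψ z)‖ ≤
      (16 * E + 528 * B * (θ₀ - θ)) / Λ := by
  have hθ0 : 0 ≤ θ := by linarith
  set c := (((1 / (θ ^ 2 * Λ)) : ℝ) : ℂ) with hc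
  set c₀ := (((1 / (θ₀ ^ 2 * Λ)) : ℝ) : ℂ) with hc₀
  have hcn : ‖c‖ ≤ 16 / Λ := norm_coeff_sq_le hΛ hθ
  have hcc : ‖c - c₀‖ ≤ 512 * (θ₀ - θ) / Λ := norm_coeff_sq_sub_le hΛ hθ hθθ hθ₀
  -- the three pieces
  have i1 : ‖(∫ z in (0:ℝ)..θ, φ z) - ∫ z in (0:ℝ)..θ, ψ z‖ ≤ E * θ := by
    rw [← intervalIntegral.integral_sub (hφ.intervalIntegrable _ _) (hψ.intervalIntegrable _ _)]
    have := intervalIntegral.norm_integral_le_of_norm_le_const (a := 0) (b := θ) (C := E)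
      (f := fun z => φ z - ψ z) (fun z hz => by
        rw [Set.uIoc_of_le hθ0] at hz
        exact hE' z hz.1.le hz.2)
    simpa [abs_of_nonneg hθ0] using this
  have i2 : ‖(∫ z in (0:ℝ)..θ, ψ z) - ∫ z in (0:ℝ)..θ₀, ψ z‖ ≤ B * (θ₀ - θ) := by
    rw [← intervalIntegral.integral_add_adjacent_intervals (hψ.intervalIntegrable 0 θ)
      (hψ.intervalIntegrable θ θ₀), sub_add_cancel_left, norm_neg]
    have := intervalIntegral.norm_integral_le_of_norm_le_const (a := θ) (b := θ₀) (C := B)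
      (f := fun z => ψ z) (fun z hz => by
        rw [Set.uIoc_of_le hθθ] at hz
        exact hB' z (by linarith [hz.1]) hz.2)
    simpa [abs_of_nonneg (show 0 ≤ θ₀ - θ by linarith)] using this
  have i3 : ‖∫ z in (0:ℝ)..θ₀, ψ z‖ ≤ B * θ₀ := by
    have := intervalIntegral.norm_integral_le_of_norm_le_const (a := 0) (b := θ₀) (C := B)
      (f := fun z => ψ z) (fun z hz => by
        rw [Set.uIoc_of_le (hθ0.trans hθθ)] at hz
        exact hB' z hz.1.le hz.2)
    simpa [abs_of_nonneg (hθ0.trans hθθ)] using this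
  -- combine
  have split : c * (∫ z in (0:ℝ)..θ, φ z) - c₀ * (∫ z in (0:ℝ)..θ₀, ψ z) =
      c * ((∫ z in (0:ℝ)..θ, φ z) - ∫ z in (0:ℝ)..θ, ψ z) +
        c * ((∫ z in (0:ℝ)..θ, ψ z) - ∫ z in (0:ℝ)..θ₀, ψ z) +
        (c - c₀) * ∫ z in (0:ℝ)..θ₀, ψ z := by ring
  rw [split]
  have hc0 : 0 ≤ ‖c‖ := norm_nonneg _
  have hd : 0 ≤ θ₀ - θ := by linarith
  have t1 : ‖c‖ * (E * θ) ≤ 16 / Λ * E := by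
    have : E * θ ≤ E := by nlinarith
    calc ‖c‖ * (E * θ) ≤ ‖c‖ * E := mul_le_mul_of_nonneg_left this hc0
      _ ≤ 16 / Λ * E := mul_le_mul_of_nonneg_right hcn hE
  have t2 : ‖c‖ * (B * (θ₀ - θ)) ≤ 16 / Λ * (B * (θ₀ - θ)) :=
    mul_le_mul_of_nonneg_right hcn (mul_nonneg hB hd)
  have t3 : ‖c - c₀‖ * (B * θ₀) ≤ 512 * (θ₀ - θ) / Λ * B := by
    have : B * θ₀ ≤ B := by nlinarith
    calc ‖c - c₀‖ * (B * θ₀) ≤ ‖c - c₀‖ * B := mul_le_mul_of_nonneg_left this (norm_nonneg _)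
      _ ≤ 512 * (θ₀ - θ) / Λ * B := mul_le_mul_of_nonneg_right hcc hB
  calc ‖c * ((∫ z in (0:ℝ)..θ, φ z) - ∫ z in (0:ℝ)..θ, ψ z) +
        c * ((∫ z in (0:ℝ)..θ, ψ z) - ∫ z in (0:ℝ)..θ₀, ψ z) + (c - c₀) * ∫ z in (0:ℝ)..θ₀, ψ z‖
      ≤ ‖c‖ * (E * θ) + ‖c‖ * (B * (θ₀ - θ)) + ‖c - c₀‖ * (B * θ₀) := by
        refine (norm_add_le _ _).trans (add_le_add ((norm_add_le _ _).trans (add_le_add ?_ ?_)) ?_)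
        · rw [norm_mul]; exact mul_le_mul_of_nonneg_left i1 hc0
        · rw [norm_mul]; exact mul_le_mul_of_nonneg_left i2 hc0
        · rw [norm_mul]; exact mul_le_mul_of_nonneg_left i3 (norm_nonneg _)
    _ ≤ 16 / Λ * E + 16 / Λ * (B * (θ₀ - θ)) + 512 * (θ₀ - θ) / Λ * B := by linarith
    _ = (16 * E + 528 * B * (θ₀ - θ)) / Λ := by field_simp; ring

/-- **Cross `z`-form perturbation.** For continuous `φ, ψ` with `‖φ − ψ‖ ≤ E` and `‖ψ‖ ≤ B` on
`[0, θ_S]` (`1/4 ≤ θ_S ≤ 1`, `1/4 ≤ θ ≤ θ₀`, `Λ > 0`):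
`‖(θθ_SΛ)⁻¹∫₀^{θ_S} φ − (θ₀θ_SΛ)⁻¹∫₀^{θ_S} ψ‖ ≤ (16E + 64B(θ₀ − θ))/Λ`. [folklore] -/
private theorem zform_cross_perturb {φ ψ : ℝ → ℂ} (hφ : Continuous φ) (hψ : Continuous ψ)
    {θ θ₀ θS Λ E B : ℝ} (hΛ : 0 < Λ) (hθ : 1 / 4 ≤ θ) (hθθ : θ ≤ θ₀) (hS : 1 / 4 ≤ θS) (hS1 : θS ≤ 1)
    (hE : 0 ≤ E) (hB : 0 ≤ B) (hE' : ∀ z, 0 ≤ z → z ≤ θS → ‖φ z - ψ z‖ ≤ E)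
    (hB' : ∀ z, 0 ≤ z → z ≤ θS → ‖ψ z‖ ≤ B) :
    ‖(((1 / (θ * θS * Λ)) : ℝ) : ℂ) * (∫ z in (0:ℝ)..θS, φ z) -
        (((1 / (θ₀ * θS * Λ)) : ℝ) : ℂ) * (∫ z in (0:ℝ)..θS, ψ z)‖ ≤
      (16 * E + 64 * B * (θ₀ - θ)) / Λ := by
  have hS0 : 0 ≤ θS := by linarith
  set c := (((1 / (θ * θS * Λ)) : ℝ) : ℂ) with hc
  set c₀ := (((1 / (θ₀ * θS * Λ)) : ℝ) : ℂ) with hc₀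
  have hcn : ‖c‖ ≤ 16 / Λ := norm_coeff_mul_le hΛ hθ hS
  have hcc : ‖c - c₀‖ ≤ 64 * (θ₀ - θ) / Λ := norm_coeff_mul_sub_le hΛ hθ hθθ hS
  have i1 : ‖(∫ z in (0:ℝ)..θS, φ z) - ∫ z in (0:ℝ)..θS, ψ z‖ ≤ E * θS := by
    rw [← intervalIntegral.integral_sub (hφ.intervalIntegrable _ _) (hψ.intervalIntegrable _ _)]
    have := intervalIntegral.norm_integral_le_of_norm_le_const (a := 0) (b := θS) (C := E)
      (f := fun z => φ z - ψ z) (fun z hz => by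
        rw [Set.uIoc_of_le hS0] at hz
        exact hE' z hz.1.le hz.2)
    simpa [abs_of_nonneg hS0] using this
  have i3 : ‖∫ z in (0:ℝ)..θS, ψ z‖ ≤ B * θS := by
    have := intervalIntegral.norm_integral_le_of_norm_le_const (a := 0) (b := θS) (C := B)
      (f := fun z => ψ z) (fun z hz => by
        rw [Set.uIoc_of_le hS0] at hz
        exact hB' z hz.1.le hz.2)
    simpa [abs_of_nonneg hS0] using this
  have split : c * (∫ z in (0:ℝ)..θS, φ z) - c₀ * (∫ z in (0:ℝ)..θS, ψ z) =
      c * ((∫ z in (0:ℝ)..θS, φ z) - ∫ z in (0:ℝ)..θS, ψ z) + (c - c₀) * ∫ z in (0:ℝ)..θS, ψ z := by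
    ring
  rw [split]
  have hd : 0 ≤ θ₀ - θ := by linarith
  have t1 : ‖c‖ * (E * θS) ≤ 16 / Λ * E := by
    have : E * θS ≤ E := by nlinarith
    calc ‖c‖ * (E * θS) ≤ ‖c‖ * E := mul_le_mul_of_nonneg_left this (norm_nonneg _)
      _ ≤ 16 / Λ * E := mul_le_mul_of_nonneg_right hcn hE
  have t3 : ‖c - c₀‖ * (B * θS) ≤ 64 * (θ₀ - θ) / Λ * B := by
    have : B * θS ≤ B := by nlinarith
    calc ‖c - c₀‖ * (B * θS) ≤ ‖c - c₀‖ * B := mul_le_mul_of_nonneg_left this (norm_nonneg _)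
      _ ≤ 64 * (θ₀ - θ) / Λ * B := mul_le_mul_of_nonneg_right hcc hB
  calc ‖c * ((∫ z in (0:ℝ)..θS, φ z) - ∫ z in (0:ℝ)..θS, ψ z) + (c - c₀) * ∫ z in (0:ℝ)..θS, ψ z‖
      ≤ ‖c‖ * (E * θS) + ‖c - c₀‖ * (B * θS) := by
        refine (norm_add_le _ _).trans (add_le_add ?_ ?_)
        · rw [norm_mul]; exact mul_le_mul_of_nonneg_left i1 (norm_nonneg _)
        · rw [norm_mul]; exact mul_le_mul_of_nonneg_left i3 (norm_nonneg _)
    _ ≤ 16 / Λ * E + 64 * (θ₀ - θ) / Λ * B := by linarith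
    _ = (16 * E + 64 * B * (θ₀ - θ)) / Λ := by field_simp

end ZformGeneric

/-! ## Pointwise facts on the profiles as functions of `z` (`x = Pᶻ`, `L = zΛ`) -/

section ProfilePointwise

/-- `‖𝔣(β, β_μ; L)‖ ≤ 1 + A` whenever `Re β_μ = 0` and `(‖β_μ‖ + ‖β‖)|L| ≤ A` (`L` real).
[cite: Zhang2022LandauSiegel, §8 Lemma 8.2 p.45] -/
private theorem norm_frakf_le_gen {β βμ : ℂ} {L A : ℝ} (hre : βμ.re = 0)
    (hA : (‖βμ‖ + ‖β‖) * |L| ≤ A) : ‖frakf β βμ (L : ℂ)‖ ≤ 1 + A := by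
  have h1 : (βμ * (L : ℂ)).re = 0 := by rw [Complex.mul_re, hre, Complex.ofReal_im]; ring
  have hexp : ‖cexp (βμ * (L : ℂ))‖ = 1 := by rw [Complex.norm_exp, h1, Real.exp_zero]
  rw [frakf, norm_mul, hexp, mul_one]
  calc ‖1 + (βμ - β) * (L : ℂ)‖ ≤ ‖(1:ℂ)‖ + ‖(βμ - β) * (L : ℂ)‖ := norm_add_le _ _
    _ = 1 + ‖βμ - β‖ * |L| := by rw [norm_one, norm_mul, Complex.norm_real, Real.norm_eq_abs]
    _ ≤ 1 + (‖βμ‖ + ‖β‖) * |L| := by gcongr; exact norm_sub_le _ _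
    _ ≤ 1 + A := by linarith

/-- `‖𝔤(β₁, β₂, β_μ; L)‖ ≤ 1 + 2a²/m² + 4a²L_m/m` whenever `Re β_μ = 0`, `0 < m ≤ ‖β_μ‖ ≤ a`,
`‖β₁‖, ‖β₂‖ ≤ a`, `|L| ≤ L_m`. [cite: Zhang2022LandauSiegel, §8 Lemma 8.4 p.46] -/
private theorem norm_frakg_le_gen {β1 β2 βμ : ℂ} {L a m Lm : ℝ} (hre : βμ.re = 0) (hm : 0 < m)
    (hm' : m ≤ ‖βμ‖) (hμa : ‖βμ‖ ≤ a) (h1 : ‖β1‖ ≤ a) (h2 : ‖β2‖ ≤ a) (hL : |L| ≤ Lm) :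
    ‖frakg β1 β2 βμ (L : ℂ)‖ ≤ 1 + 2 * (a ^ 2 / m ^ 2) + 4 * a ^ 2 / m * Lm := by
  have ha : 0 ≤ a := (norm_nonneg _).trans h1
  have hμ0 : 0 < ‖βμ‖ := lt_of_lt_of_le hm hm'
  have h1' : (-(βμ * (L : ℂ))).re = 0 := by
    rw [Complex.neg_re, Complex.mul_re, hre, Complex.ofReal_im]; ring
  have hexp : ‖cexp (-(βμ * (L : ℂ)))‖ = 1 := by rw [Complex.norm_exp, h1', Real.exp_zero]
  have hr : ‖β1 * β2 / βμ ^ 2‖ ≤ a ^ 2 / m ^ 2 := by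
    rw [norm_div, norm_mul, norm_pow, div_le_div_iff₀ (by positivity) (by positivity)]
    have hmm : m ^ 2 ≤ ‖βμ‖ ^ 2 := pow_le_pow_left₀ hm.le hm' 2
    calc ‖β1‖ * ‖β2‖ * m ^ 2 ≤ a * a * ‖βμ‖ ^ 2 := by gcongr
      _ = a ^ 2 * ‖βμ‖ ^ 2 := by ring
  have hs : ‖(β1 - βμ) * (β2 - βμ) / βμ‖ ≤ 4 * a ^ 2 / m := by
    rw [norm_div, norm_mul, div_le_div_iff₀ hμ0 hm]
    have hd1 : ‖β1 - βμ‖ ≤ 2 * a := (norm_sub_le _ _).trans (by linarith)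
    have hd2 : ‖β2 - βμ‖ ≤ 2 * a := (norm_sub_le _ _).trans (by linarith)
    calc ‖β1 - βμ‖ * ‖β2 - βμ‖ * m ≤ (2 * a) * (2 * a) * ‖βμ‖ := by gcongr
      _ = 4 * a ^ 2 * ‖βμ‖ := by ring
  have hLn : ‖(L : ℂ)‖ ≤ Lm := by rw [Complex.norm_real, Real.norm_eq_abs]; exact hL
  have hLm : 0 ≤ Lm := (abs_nonneg _).trans hL
  rw [frakg]
  calc ‖β1 * β2 / βμ ^ 2 +
        (1 - β1 * β2 / βμ ^ 2 - (β1 - βμ) * (β2 - βμ) / βμ * (L : ℂ)) * cexp (-(βμ * (L : ℂ)))‖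
      ≤ ‖β1 * β2 / βμ ^ 2‖ +
        ‖(1 - β1 * β2 / βμ ^ 2 - (β1 - βμ) * (β2 - βμ) / βμ * (L : ℂ)) * cexp (-(βμ * (L : ℂ)))‖ :=
        norm_add_le _ _
    _ = ‖β1 * β2 / βμ ^ 2‖ + ‖1 - β1 * β2 / βμ ^ 2 - (β1 - βμ) * (β2 - βμ) / βμ * (L : ℂ)‖ := by
        rw [norm_mul, hexp, mul_one]
    _ ≤ ‖β1 * β2 / βμ ^ 2‖ + (‖(1:ℂ)‖ + ‖β1 * β2 / βμ ^ 2‖ + ‖(β1 - βμ) * (β2 - βμ) / βμ * (L : ℂ)‖) := by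
        gcongr
        exact (norm_sub_le _ _).trans (add_le_add (norm_sub_le _ _) le_rfl)
    _ ≤ a ^ 2 / m ^ 2 + (1 + a ^ 2 / m ^ 2 + 4 * a ^ 2 / m * Lm) := by
        rw [norm_one, norm_mul]
        have := mul_le_mul hs hLn (norm_nonneg _) (by positivity)
        linarith
    _ = 1 + 2 * (a ^ 2 / m ^ 2) + 4 * a ^ 2 / m * Lm := by ring

/-- `‖e^{β_μuΛ} − e^{β_μvΛ}‖ ≤ μαΛ|u − v|` for the main value `β_μ = μiα` (`μ, α ≥ 0`, `Λ ≥ 0`): the chord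
bound `‖e^{ix} − 1‖ ≤ |x|`. [folklore] -/
private theorem norm_cexp_betaMain_sub_le {μ : ℚ} {α Λ : ℝ} (hμ : 0 ≤ μ) (hα : 0 ≤ α) (hΛ : 0 ≤ Λ)
    (u v : ℝ) :
    ‖cexp (betaMain μ α * ((u * Λ : ℝ) : ℂ)) - cexp (betaMain μ α * ((v * Λ : ℝ) : ℂ))‖ ≤
      (μ : ℝ) * α * Λ * |u - v| := by
  have hμR : 0 ≤ (μ : ℝ) := by exact_mod_cast hμ
  have e1 : cexp (betaMain μ α * ((u * Λ : ℝ) : ℂ)) =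
      cexp (betaMain μ α * ((v * Λ : ℝ) : ℂ)) * cexp (Complex.I * (((μ : ℝ) * α * Λ * (u - v) : ℝ) : ℂ)) := by
    rw [← Complex.exp_add]; congr 1
    unfold betaMain; push_cast; ring
  rw [e1, ← mul_sub_one, norm_mul, Section8ShiftPerturbation.norm_cexp_betaMain_mul, one_mul]
  refine Real.norm_exp_I_mul_ofReal_sub_one_le.trans ?_
  rw [Real.norm_eq_abs, abs_mul, abs_of_nonneg (by positivity)]

/-- The same for `e^{−β_μ L}`. [folklore] -/
private theorem norm_cexp_neg_betaMain_sub_le {μ : ℚ} {α Λ : ℝ} (hμ : 0 ≤ μ) (hα : 0 ≤ α)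
    (hΛ : 0 ≤ Λ) (u v : ℝ) :
    ‖cexp (-(betaMain μ α * ((u * Λ : ℝ) : ℂ))) - cexp (-(betaMain μ α * ((v * Λ : ℝ) : ℂ)))‖ ≤
      (μ : ℝ) * α * Λ * |u - v| := by
  have hμR : 0 ≤ (μ : ℝ) := by exact_mod_cast hμ
  have e1 : cexp (-(betaMain μ α * ((u * Λ : ℝ) : ℂ))) =
      cexp (-(betaMain μ α * ((v * Λ : ℝ) : ℂ))) *
        cexp (Complex.I * (((μ : ℝ) * α * Λ * (v - u) : ℝ) : ℂ)) := by
    rw [← Complex.exp_add]; congr 1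
    unfold betaMain; push_cast; ring
  rw [e1, ← mul_sub_one, norm_mul, Section8ShiftPerturbation.norm_cexp_neg_betaMain_mul, one_mul]
  refine Real.norm_exp_I_mul_ofReal_sub_one_le.trans ?_
  rw [Real.norm_eq_abs, abs_mul, abs_of_nonneg (by positivity), abs_sub_comm]

/-- **Lipschitz bound for `z ↦ 𝔣(β, β_μ⁰; zΛ)` on `[0,1]`** (`β_μ⁰ = μiα` with `0 ≤ μ ≤ 5/2`,
`‖β‖ ≤ aα`, `αΛ = π`): constant `(5/2 + a)π(1 + (5/2)π)`... precisely
`‖𝔣(uΛ) − 𝔣(vΛ)‖ ≤ ((5/2 + a)π + (1 + (5/2 + a)π)(5/2)π)|u − v|`. [cite: Zhang2022LandauSiegel, §8 Lemma 8.2 p.45] -/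
private theorem frakf_lipschitz {β : ℂ} {μ : ℚ} {α Λ a : ℝ} (hαΛ : α * Λ = π) (hα : 0 < α)
    (hΛ : 0 < Λ) (ha : 0 ≤ a) (hβ : ‖β‖ ≤ a * α) (hμ0 : 0 ≤ μ) (hμ : (μ : ℝ) ≤ 5 / 2) {u v : ℝ}
    (hv0 : 0 ≤ v) (hv1 : v ≤ 1) :
    ‖frakf β (betaMain μ α) ((u * Λ : ℝ) : ℂ) - frakf β (betaMain μ α) ((v * Λ : ℝ) : ℂ)‖ ≤
      ((5 / 2 + a) * π + (1 + (5 / 2 + a) * π) * (5 / 2 * π)) * |u - v| := by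
  have hμR : 0 ≤ (μ : ℝ) := by exact_mod_cast hμ0
  set βμ := betaMain μ α with hβμ
  have hnμ : ‖βμ‖ = (μ : ℝ) * α := by
    rw [hβμ, norm_betaMain, abs_of_nonneg hμR, abs_of_nonneg hα.le]
  have hexp : ‖cexp (βμ * ((u * Λ : ℝ) : ℂ))‖ = 1 := Section8ShiftPerturbation.norm_cexp_betaMain_mul μ α _
  have hdiff := norm_cexp_betaMain_sub_le hμ0 hα.le hΛ.le u v (μ := μ)
  have e : frakf β βμ ((u * Λ : ℝ) : ℂ) - frakf β βμ ((v * Λ : ℝ) : ℂ) =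
      (βμ - β) * (((u - v) * Λ : ℝ) : ℂ) * cexp (βμ * ((u * Λ : ℝ) : ℂ)) +
        (1 + (βμ - β) * ((v * Λ : ℝ) : ℂ)) *
          (cexp (βμ * ((u * Λ : ℝ) : ℂ)) - cexp (βμ * ((v * Λ : ℝ) : ℂ))) := by
    unfold frakf; push_cast; ring
  rw [e]
  have hsum : ‖βμ - β‖ ≤ (5 / 2 + a) * α := by
    calc ‖βμ - β‖ ≤ ‖βμ‖ + ‖β‖ := norm_sub_le _ _
      _ ≤ 5 / 2 * α + a * α := by rw [hnμ]; gcongr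
      _ = (5 / 2 + a) * α := by ring
  have t1 : ‖(βμ - β) * (((u - v) * Λ : ℝ) : ℂ) * cexp (βμ * ((u * Λ : ℝ) : ℂ))‖ ≤
      (5 / 2 + a) * π * |u - v| := by
    rw [norm_mul, norm_mul, hexp, mul_one, Complex.norm_real, Real.norm_eq_abs, abs_mul,
      abs_of_pos hΛ]
    calc ‖βμ - β‖ * (|u - v| * Λ) ≤ (5 / 2 + a) * α * (|u - v| * Λ) := by gcongr
      _ = (5 / 2 + a) * (α * Λ) * |u - v| := by ring
      _ = (5 / 2 + a) * π * |u - v| := by rw [hαΛ]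
  have t2 : ‖(1 + (βμ - β) * ((v * Λ : ℝ) : ℂ)) *
      (cexp (βμ * ((u * Λ : ℝ) : ℂ)) - cexp (βμ * ((v * Λ : ℝ) : ℂ)))‖ ≤
      (1 + (5 / 2 + a) * π) * (5 / 2 * π * |u - v|) := by
    rw [norm_mul]
    have hA : ‖1 + (βμ - β) * ((v * Λ : ℝ) : ℂ)‖ ≤ 1 + (5 / 2 + a) * π := by
      calc ‖1 + (βμ - β) * ((v * Λ : ℝ) : ℂ)‖ ≤ ‖(1:ℂ)‖ + ‖(βμ - β) * ((v * Λ : ℝ) : ℂ)‖ := norm_add_le _ _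
        _ = 1 + ‖βμ - β‖ * (v * Λ) := by
            rw [norm_one, norm_mul, Complex.norm_real, Real.norm_eq_abs, abs_of_nonneg (by positivity)]
        _ ≤ 1 + (5 / 2 + a) * α * (1 * Λ) := by gcongr
        _ = 1 + (5 / 2 + a) * π := by rw [one_mul, mul_assoc, hαΛ]
    have hB : ‖cexp (βμ * ((u * Λ : ℝ) : ℂ)) - cexp (βμ * ((v * Λ : ℝ) : ℂ))‖ ≤ 5 / 2 * π * |u - v| := by
      refine hdiff.trans ?_
      have : (μ : ℝ) * α * Λ ≤ 5 / 2 * π := by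
        rw [mul_assoc, hαΛ]; exact mul_le_mul_of_nonneg_right hμ Real.pi_pos.le
      exact mul_le_mul_of_nonneg_right this (abs_nonneg _)
    exact mul_le_mul hA hB (norm_nonneg _) (by positivity)
  calc _ ≤ (5 / 2 + a) * π * |u - v| + (1 + (5 / 2 + a) * π) * (5 / 2 * π * |u - v|) :=
        (norm_add_le _ _).trans (add_le_add t1 t2)
    _ = ((5 / 2 + a) * π + (1 + (5 / 2 + a) * π) * (5 / 2 * π)) * |u - v| := by ring

/-- **Lipschitz bound for `z ↦ 𝔤(β₁, β₂, β_μ⁰; zΛ)` on `[0,1]`** (`β_μ⁰ = μiα`, `3/2 ≤ μ ≤ 5/2`,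
`‖β₁‖, ‖β₂‖ ≤ aα` with `a ≥ 5/2`, `αΛ = π`):
`‖𝔤(uΛ) − 𝔤(vΛ)‖ ≤ ((8/3)a²π + (1 + (4/9)·… )…)|u − v|` with the explicit constant below.
[cite: Zhang2022LandauSiegel, §8 Lemma 8.4 p.46] -/
private theorem frakg_lipschitz {β1 β2 : ℂ} {μ : ℚ} {α Λ a : ℝ} (hαΛ : α * Λ = π) (hα : 0 < α)
    (hΛ : 0 < Λ) (ha : 5 / 2 ≤ a) (h1 : ‖β1‖ ≤ a * α) (h2 : ‖β2‖ ≤ a * α) (hμ0 : (3 : ℚ) / 2 ≤ μ)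
    (hμ : (μ : ℝ) ≤ 5 / 2) {u v : ℝ} (hv0 : 0 ≤ v) (hv1 : v ≤ 1) :
    ‖frakg β1 β2 (betaMain μ α) ((u * Λ : ℝ) : ℂ) - frakg β1 β2 (betaMain μ α) ((v * Λ : ℝ) : ℂ)‖ ≤
      (8 / 3 * a ^ 2 * π + (1 + 4 / 9 * a ^ 2 + 8 / 3 * a ^ 2 * π) * (5 / 2 * π)) * |u - v| := by
  have hμ0' : 0 ≤ μ := le_trans (by norm_num) hμ0
  have hμR : (3 : ℝ) / 2 ≤ (μ : ℝ) := by
    have h := (Rat.cast_le (K := ℝ)).mpr hμ0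
    push_cast at h; exact h
  have hμR0 : 0 ≤ (μ : ℝ) := by linarith
  set βμ := betaMain μ α with hβμ
  have hnμ : ‖βμ‖ = (μ : ℝ) * α := by
    rw [hβμ, norm_betaMain, abs_of_nonneg hμR0, abs_of_nonneg hα.le]
  have hm : 3 / 2 * α ≤ ‖βμ‖ := by rw [hnμ]; exact mul_le_mul_of_nonneg_right hμR hα.le
  have hm0 : 0 < ‖βμ‖ := lt_of_lt_of_le (by positivity) hm
  have hμa : ‖βμ‖ ≤ a * α := by
    rw [hnμ]; exact mul_le_mul_of_nonneg_right (hμ.trans ha) hα.le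
  have hexp : ‖cexp (-(βμ * ((u * Λ : ℝ) : ℂ)))‖ = 1 :=
    Section8ShiftPerturbation.norm_cexp_neg_betaMain_mul μ α _
  have hdiff := norm_cexp_neg_betaMain_sub_le hμ0' hα.le hΛ.le u v (μ := μ)
  set r := β1 * β2 / βμ ^ 2 with hr
  set s := (β1 - βμ) * (β2 - βμ) / βμ with hs
  have hrn : ‖r‖ ≤ 4 / 9 * a ^ 2 := by
    rw [hr, norm_div, norm_mul, norm_pow, div_le_iff₀ (by positivity)]
    have hmm : (3 / 2 * α) ^ 2 ≤ ‖βμ‖ ^ 2 := pow_le_pow_left₀ (by positivity) hm 2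
    calc ‖β1‖ * ‖β2‖ ≤ (a * α) * (a * α) := by gcongr
      _ = 4 / 9 * a ^ 2 * (3 / 2 * α) ^ 2 := by ring
      _ ≤ 4 / 9 * a ^ 2 * ‖βμ‖ ^ 2 := by gcongr
  have hsn : ‖s‖ ≤ 8 / 3 * a ^ 2 * α := by
    rw [hs, norm_div, norm_mul, div_le_iff₀ hm0]
    have hd1 : ‖β1 - βμ‖ ≤ 2 * a * α := (norm_sub_le _ _).trans (by linarith)
    have hd2 : ‖β2 - βμ‖ ≤ 2 * a * α := (norm_sub_le _ _).trans (by linarith)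
    calc ‖β1 - βμ‖ * ‖β2 - βμ‖ ≤ (2 * a * α) * (2 * a * α) := by gcongr
      _ = 8 / 3 * a ^ 2 * α * (3 / 2 * α) := by ring
      _ ≤ 8 / 3 * a ^ 2 * α * ‖βμ‖ := by gcongr
  have e : frakg β1 β2 βμ ((u * Λ : ℝ) : ℂ) - frakg β1 β2 βμ ((v * Λ : ℝ) : ℂ) =
      -(s * (((u - v) * Λ : ℝ) : ℂ)) * cexp (-(βμ * ((u * Λ : ℝ) : ℂ))) +
        (1 - r - s * ((v * Λ : ℝ) : ℂ)) *
          (cexp (-(βμ * ((u * Λ : ℝ) : ℂ))) - cexp (-(βμ * ((v * Λ : ℝ) : ℂ)))) := by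
    rw [hr, hs]; unfold frakg; push_cast; ring
  rw [e]
  have t1 : ‖-(s * (((u - v) * Λ : ℝ) : ℂ)) * cexp (-(βμ * ((u * Λ : ℝ) : ℂ)))‖ ≤
      8 / 3 * a ^ 2 * π * |u - v| := by
    rw [norm_mul, norm_neg, norm_mul, hexp, mul_one, Complex.norm_real, Real.norm_eq_abs, abs_mul,
      abs_of_pos hΛ]
    calc ‖s‖ * (|u - v| * Λ) ≤ (8 / 3 * a ^ 2 * α) * (|u - v| * Λ) := by gcongr
      _ = 8 / 3 * a ^ 2 * (α * Λ) * |u - v| := by ring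
      _ = 8 / 3 * a ^ 2 * π * |u - v| := by rw [hαΛ]
  have t2 : ‖(1 - r - s * ((v * Λ : ℝ) : ℂ)) *
      (cexp (-(βμ * ((u * Λ : ℝ) : ℂ))) - cexp (-(βμ * ((v * Λ : ℝ) : ℂ))))‖ ≤
      (1 + 4 / 9 * a ^ 2 + 8 / 3 * a ^ 2 * π) * (5 / 2 * π * |u - v|) := by
    rw [norm_mul]
    have hA : ‖1 - r - s * ((v * Λ : ℝ) : ℂ)‖ ≤ 1 + 4 / 9 * a ^ 2 + 8 / 3 * a ^ 2 * π := by
      calc ‖1 - r - s * ((v * Λ : ℝ) : ℂ)‖ ≤ ‖(1:ℂ)‖ + ‖r‖ + ‖s * ((v * Λ : ℝ) : ℂ)‖ :=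
            (norm_sub_le _ _).trans (add_le_add (norm_sub_le _ _) le_rfl)
        _ = 1 + ‖r‖ + ‖s‖ * (v * Λ) := by
            rw [norm_one, norm_mul, Complex.norm_real, Real.norm_eq_abs, abs_of_nonneg (by positivity)]
        _ ≤ 1 + 4 / 9 * a ^ 2 + (8 / 3 * a ^ 2 * α) * (1 * Λ) := by gcongr
        _ = 1 + 4 / 9 * a ^ 2 + 8 / 3 * a ^ 2 * π := by rw [one_mul, mul_assoc, hαΛ]
    have hB : ‖cexp (-(βμ * ((u * Λ : ℝ) : ℂ))) - cexp (-(βμ * ((v * Λ : ℝ) : ℂ)))‖ ≤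
        5 / 2 * π * |u - v| := by
      refine hdiff.trans ?_
      have : (μ : ℝ) * α * Λ ≤ 5 / 2 * π := by
        rw [mul_assoc, hαΛ]; exact mul_le_mul_of_nonneg_right hμ Real.pi_pos.le
      exact mul_le_mul_of_nonneg_right this (abs_nonneg _)
    exact mul_le_mul hA hB (norm_nonneg _) (by positivity)
  calc _ ≤ 8 / 3 * a ^ 2 * π * |u - v| +
        (1 + 4 / 9 * a ^ 2 + 8 / 3 * a ^ 2 * π) * (5 / 2 * π * |u - v|) :=
        (norm_add_le _ _).trans (add_le_add t1 t2)
    _ = _ := by ring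

end ProfilePointwise

/-! ## The `z`-form of `S812g` at scales `(θ, 0.498)` versus `(1/2, 0.498)`: abstract comparison -/


section ZformCompare

set_option maxHeartbeats 400000 in
/-- **Abstract comparison of two `z`-forms** at long scales `θ ≤ 1/2` vs `1/2` (short scale `0.498`):
profiles within `η` of each other and bounded by `K` on `[0,1]`, the reference long profiles `m₇, n₇`
Lipschitz with constant `L` on `[0,1]`; then the two `Zform`s differ by
`≤ (‖u_L‖+‖u_S‖)²·(‖v_L‖+‖v_S‖)⁰… ` — precisely by `N·(64(2Kη + KL(1/2−θ)) + 656K²(1/2−θ))/Λ` with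
`N = (‖u_L‖ + ‖u_S‖)(‖v_L‖ + ‖v_S‖)`. [folklore] -/
private theorem Zform_sub_Zform_le {uL uS vL vS : ℂ} {f7 f6 g7 g6 m7 m6 n7 n6 : ℝ → ℂ}
    (hf7 : Continuous f7) (hf6 : Continuous f6) (hg7 : Continuous g7) (hg6 : Continuous g6)
    (hm7 : Continuous m7) (hm6 : Continuous m6) (hn7 : Continuous n7) (hn6 : Continuous n6)
    {Λ θ K η L : ℝ} (hΛ : 0 < Λ) (hθ : 0.498 ≤ θ) (hθ' : θ ≤ 1 / 2) (hK : 1 ≤ K) (hη : 0 ≤ η)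
    (hL : 0 ≤ L)
    (bf : ∀ u, 0 ≤ u → u ≤ 1 → ‖f7 u‖ ≤ K ∧ ‖f6 u‖ ≤ K ∧ ‖g7 u‖ ≤ K ∧ ‖g6 u‖ ≤ K)
    (bm : ∀ u, 0 ≤ u → u ≤ 1 → ‖m7 u‖ ≤ K ∧ ‖m6 u‖ ≤ K ∧ ‖n7 u‖ ≤ K ∧ ‖n6 u‖ ≤ K)
    (ap : ∀ u, 0 ≤ u → u ≤ 1 →
      ‖f7 u - m7 u‖ ≤ η ∧ ‖f6 u - m6 u‖ ≤ η ∧ ‖g7 u - n7 u‖ ≤ η ∧ ‖g6 u - n6 u‖ ≤ η)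
    (lip : ∀ u v, 0 ≤ u → u ≤ 1 → 0 ≤ v → v ≤ 1 →
      ‖m7 u - m7 v‖ ≤ L * |u - v| ∧ ‖n7 u - n7 v‖ ≤ L * |u - v|) :
    ‖(uL * vL * ((1 / (θ ^ 2 * Λ) : ℝ) : ℂ) * (∫ z in (0:ℝ)..θ, f7 z * g7 z)
        + uS * vS * ((1 / ((0.498:ℝ) ^ 2 * Λ) : ℝ) : ℂ) * (∫ z in (0:ℝ)..0.498, f6 z * g6 z)
        + ((1 / (θ * 0.498 * Λ) : ℝ) : ℂ)
          * (uS * vL * (∫ z in (0:ℝ)..0.498, f6 z * g7 (z + (θ - 0.498)))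
              + uL * vS * (∫ z in (0:ℝ)..0.498, f7 (z + (θ - 0.498)) * g6 z)))
      - (uL * vL * ((1 / ((1 / 2) ^ 2 * Λ) : ℝ) : ℂ) * (∫ z in (0:ℝ)..(1 / 2), m7 z * n7 z)
        + uS * vS * ((1 / ((0.498:ℝ) ^ 2 * Λ) : ℝ) : ℂ) * (∫ z in (0:ℝ)..0.498, m6 z * n6 z)
        + ((1 / ((1 / 2) * 0.498 * Λ) : ℝ) : ℂ)
          * (uS * vL * (∫ z in (0:ℝ)..0.498, m6 z * n7 (z + ((1 / 2) - 0.498)))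
              + uL * vS * (∫ z in (0:ℝ)..0.498, m7 (z + ((1 / 2) - 0.498)) * n6 z)))‖ ≤
      (‖uL‖ + ‖uS‖) * (‖vL‖ + ‖vS‖) *
        ((64 * (2 * K * η + K * L * (1 / 2 - θ)) + 656 * K ^ 2 * (1 / 2 - θ)) / Λ) := by
  have hK0 : 0 ≤ K := by linarith
  have hd : 0 ≤ 1 / 2 - θ := by linarith
  have hθq : (1:ℝ) / 4 ≤ θ := by linarith
  have hSq : (1:ℝ) / 4 ≤ 0.498 := by norm_num
  have hS1 : (0.498:ℝ) ≤ 1 := by norm_num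
  -- pointwise: products
  have prod_bd : ∀ {a b : ℂ}, ‖a‖ ≤ K → ‖b‖ ≤ K → ‖a * b‖ ≤ K ^ 2 := by
    intro a b ha hb; rw [norm_mul, sq]; exact mul_le_mul ha hb (norm_nonneg _) hK0
  have prod_df : ∀ {a b a' b' : ℂ}, ‖a‖ ≤ K → ‖b'‖ ≤ K → ‖a - a'‖ ≤ η → ‖b - b'‖ ≤ η →
      ‖a * b - a' * b'‖ ≤ 2 * K * η := by
    intro a b a' b' ha hb' hda hdb
    have e : a * b - a' * b' = a * (b - b') + (a - a') * b' := by ring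
    rw [e]
    calc ‖a * (b - b') + (a - a') * b'‖ ≤ ‖a‖ * ‖b - b'‖ + ‖a - a'‖ * ‖b'‖ :=
          (norm_add_le _ _).trans (by rw [norm_mul, norm_mul])
      _ ≤ K * η + η * K := by gcongr
      _ = 2 * K * η := by ring
  -- (1) the long diagonal term
  have T1 := zform_diag_perturb (φ := fun z => f7 z * g7 z) (ψ := fun z => m7 z * n7 z)
    (hf7.mul hg7) (hm7.mul hn7) (θ := θ) (θ₀ := 1 / 2) (Λ := Λ) (E := 2 * K * η) (B := K ^ 2)
    hΛ hθq hθ' (by norm_num) (by positivity) (by positivity)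
    (fun z hz0 hz1 => by
      have hz1' : z ≤ 1 := by linarith
      exact prod_df (bf z hz0 hz1').1 (bm z hz0 hz1').2.2.1 (ap z hz0 hz1').1 (ap z hz0 hz1').2.2.1)
    (fun z hz0 hz1 => by
      have hz1' : z ≤ 1 := by linarith
      exact prod_bd (bm z hz0 hz1').1 (bm z hz0 hz1').2.2.1)
  -- (2) the short diagonal term (same scale on both sides)
  have T2 := zform_diag_perturb (φ := fun z => f6 z * g6 z) (ψ := fun z => m6 z * n6 z)
    (hf6.mul hg6) (hm6.mul hn6) (θ := 0.498) (θ₀ := 0.498) (Λ := Λ) (E := 2 * K * η) (B := K ^ 2)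
    hΛ hSq le_rfl hS1 (by positivity) (by positivity)
    (fun z hz0 hz1 => by
      have hz1' : z ≤ 1 := by linarith
      exact prod_df (bf z hz0 hz1').2.1 (bm z hz0 hz1').2.2.2 (ap z hz0 hz1').2.1 (ap z hz0 hz1').2.2.2)
    (fun z hz0 hz1 => by
      have hz1' : z ≤ 1 := by linarith
      exact prod_bd (bm z hz0 hz1').2.1 (bm z hz0 hz1').2.2.2)
  -- (3) first cross term: f6(z) g7(z + δ) vs m6(z) n7(z + δ₀)
  have T3 := zform_cross_perturb (φ := fun z => f6 z * g7 (z + (θ - 0.498)))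
    (ψ := fun z => m6 z * n7 (z + (1 / 2 - 0.498)))
    (hf6.mul (hg7.comp (continuous_id.add continuous_const)))
    (hm6.mul (hn7.comp (continuous_id.add continuous_const)))
    (θ := θ) (θ₀ := 1 / 2) (θS := 0.498) (Λ := Λ) (E := 2 * K * η + K * (L * (1 / 2 - θ)))
    (B := K ^ 2) hΛ hθq hθ' hSq hS1 (by positivity) (by positivity)
    (fun z hz0 hz1 => by
      have hz1' : z ≤ 1 := by linarith
      have hw0 : 0 ≤ z + (θ - 0.498) := by linarith
      have hw1 : z + (θ - 0.498) ≤ 1 := by linarith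
      have hw0' : 0 ≤ z + (1 / 2 - 0.498) := by linarith
      have hw1' : z + (1 / 2 - 0.498) ≤ 1 := by linarith
      have e : f6 z * g7 (z + (θ - 0.498)) - m6 z * n7 (z + (1 / 2 - 0.498)) =
          (f6 z * g7 (z + (θ - 0.498)) - m6 z * n7 (z + (θ - 0.498))) +
            m6 z * (n7 (z + (θ - 0.498)) - n7 (z + (1 / 2 - 0.498))) := by ring
      rw [e]
      refine (norm_add_le _ _).trans (add_le_add ?_ ?_)
      · exact prod_df (bf z hz0 hz1').2.1 (bm _ hw0 hw1).2.2.1 (ap z hz0 hz1').2.1 (ap _ hw0 hw1).2.2.1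
      · rw [norm_mul]
        refine mul_le_mul (bm z hz0 hz1').2.1 ?_ (norm_nonneg _) hK0
        refine ((lip _ _ hw0 hw1 hw0' hw1').2).trans ?_
        rw [show z + (θ - 0.498) - (z + (1 / 2 - 0.498)) = -(1 / 2 - θ) by ring, abs_neg,
          abs_of_nonneg hd])
    (fun z hz0 hz1 => by
      have hz1' : z ≤ 1 := by linarith
      exact prod_bd (bm z hz0 hz1').2.1 (bm _ (by linarith) (by linarith)).2.2.1)
  -- (4) second cross term: f7(z + δ) g6(z) vs m7(z + δ₀) n6(z)
  have T4 := zform_cross_perturb (φ := fun z => f7 (z + (θ - 0.498)) * g6 z)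
    (ψ := fun z => m7 (z + (1 / 2 - 0.498)) * n6 z)
    ((hf7.comp (continuous_id.add continuous_const)).mul hg6)
    ((hm7.comp (continuous_id.add continuous_const)).mul hn6)
    (θ := θ) (θ₀ := 1 / 2) (θS := 0.498) (Λ := Λ) (E := 2 * K * η + K * (L * (1 / 2 - θ)))
    (B := K ^ 2) hΛ hθq hθ' hSq hS1 (by positivity) (by positivity)
    (fun z hz0 hz1 => by
      have hz1' : z ≤ 1 := by linarith
      have hw0 : 0 ≤ z + (θ - 0.498) := by linarith
      have hw1 : z + (θ - 0.498) ≤ 1 := by linarith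
      have hw0' : 0 ≤ z + (1 / 2 - 0.498) := by linarith
      have hw1' : z + (1 / 2 - 0.498) ≤ 1 := by linarith
      have e : f7 (z + (θ - 0.498)) * g6 z - m7 (z + (1 / 2 - 0.498)) * n6 z =
          (f7 (z + (θ - 0.498)) * g6 z - m7 (z + (θ - 0.498)) * n6 z) +
            (m7 (z + (θ - 0.498)) - m7 (z + (1 / 2 - 0.498))) * n6 z := by ring
      rw [e]
      refine (norm_add_le _ _).trans (add_le_add ?_ ?_)
      · exact prod_df (bf _ hw0 hw1).1 (bm z hz0 hz1').2.2.2 (ap _ hw0 hw1).1 (ap z hz0 hz1').2.2.2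
      · rw [norm_mul]
        calc ‖m7 (z + (θ - 0.498)) - m7 (z + (1 / 2 - 0.498))‖ * ‖n6 z‖
            ≤ (L * (1 / 2 - θ)) * K := by
              refine mul_le_mul ?_ (bm z hz0 hz1').2.2.2 (norm_nonneg _) (by positivity)
              refine ((lip _ _ hw0 hw1 hw0' hw1').1).trans ?_
              rw [show z + (θ - 0.498) - (z + (1 / 2 - 0.498)) = -(1 / 2 - θ) by ring, abs_neg,
                abs_of_nonneg hd]
          _ = K * (L * (1 / 2 - θ)) := by ring)
    (fun z hz0 hz1 => by
      have hz1' : z ≤ 1 := by linarith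
      exact prod_bd (bm _ (by linarith) (by linarith)).1 (bm z hz0 hz1').2.2.2)
  -- assemble
  have e : (uL * vL * ((1 / (θ ^ 2 * Λ) : ℝ) : ℂ) * (∫ z in (0:ℝ)..θ, f7 z * g7 z)
        + uS * vS * ((1 / ((0.498:ℝ) ^ 2 * Λ) : ℝ) : ℂ) * (∫ z in (0:ℝ)..0.498, f6 z * g6 z)
        + ((1 / (θ * 0.498 * Λ) : ℝ) : ℂ)
          * (uS * vL * (∫ z in (0:ℝ)..0.498, f6 z * g7 (z + (θ - 0.498)))
              + uL * vS * (∫ z in (0:ℝ)..0.498, f7 (z + (θ - 0.498)) * g6 z)))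
      - (uL * vL * ((1 / ((1 / 2) ^ 2 * Λ) : ℝ) : ℂ) * (∫ z in (0:ℝ)..(1 / 2), m7 z * n7 z)
        + uS * vS * ((1 / ((0.498:ℝ) ^ 2 * Λ) : ℝ) : ℂ) * (∫ z in (0:ℝ)..0.498, m6 z * n6 z)
        + ((1 / ((1 / 2) * 0.498 * Λ) : ℝ) : ℂ)
          * (uS * vL * (∫ z in (0:ℝ)..0.498, m6 z * n7 (z + ((1 / 2) - 0.498)))
              + uL * vS * (∫ z in (0:ℝ)..0.498, m7 (z + ((1 / 2) - 0.498)) * n6 z))) =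
      uL * vL * ((((1 / (θ ^ 2 * Λ)) : ℝ) : ℂ) * (∫ z in (0:ℝ)..θ, f7 z * g7 z) -
        (((1 / ((1 / 2) ^ 2 * Λ)) : ℝ) : ℂ) * (∫ z in (0:ℝ)..(1 / 2), m7 z * n7 z)) +
      uS * vS * ((((1 / ((0.498:ℝ) ^ 2 * Λ)) : ℝ) : ℂ) * (∫ z in (0:ℝ)..0.498, f6 z * g6 z) -
        (((1 / ((0.498:ℝ) ^ 2 * Λ)) : ℝ) : ℂ) * (∫ z in (0:ℝ)..0.498, m6 z * n6 z)) +
      uS * vL * ((((1 / (θ * 0.498 * Λ)) : ℝ) : ℂ) * (∫ z in (0:ℝ)..0.498, f6 z * g7 (z + (θ - 0.498))) -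
        (((1 / (1 / 2 * 0.498 * Λ)) : ℝ) : ℂ) * (∫ z in (0:ℝ)..0.498, m6 z * n7 (z + (1 / 2 - 0.498)))) +
      uL * vS * ((((1 / (θ * 0.498 * Λ)) : ℝ) : ℂ) * (∫ z in (0:ℝ)..0.498, f7 (z + (θ - 0.498)) * g6 z) -
        (((1 / (1 / 2 * 0.498 * Λ)) : ℝ) : ℂ) * (∫ z in (0:ℝ)..0.498, m7 (z + (1 / 2 - 0.498)) * n6 z)) := by
    ring
  rw [e]
  have nL : ‖uL‖ ≤ ‖uL‖ + ‖uS‖ := le_add_of_nonneg_right (norm_nonneg _)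
  have nS : ‖uS‖ ≤ ‖uL‖ + ‖uS‖ := le_add_of_nonneg_left (norm_nonneg _)
  have mL : ‖vL‖ ≤ ‖vL‖ + ‖vS‖ := le_add_of_nonneg_right (norm_nonneg _)
  have mS : ‖vS‖ ≤ ‖vL‖ + ‖vS‖ := le_add_of_nonneg_left (norm_nonneg _)
  set N := (‖uL‖ + ‖uS‖) * (‖vL‖ + ‖vS‖) with hN
  have hN0 : 0 ≤ N := by positivity
  have cN : ∀ (a b : ℂ), ‖a‖ ≤ ‖uL‖ + ‖uS‖ → ‖b‖ ≤ ‖vL‖ + ‖vS‖ → ‖a * b‖ ≤ N := by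
    intro a b ha hb; rw [norm_mul, hN]; exact mul_le_mul ha hb (norm_nonneg _) (by positivity)
  -- each of the four terms is ≤ N * (its bound)
  set X1 := (16 * (2 * K * η) + 528 * K ^ 2 * (1 / 2 - θ)) / Λ
  set X2 := (16 * (2 * K * η) + 528 * K ^ 2 * (0.498 - 0.498)) / Λ
  set X3 := (16 * (2 * K * η + K * (L * (1 / 2 - θ))) + 64 * K ^ 2 * (1 / 2 - θ)) / Λ
  have b1 := mul_le_mul (cN uL vL nL mL) T1 (norm_nonneg _) hN0
  have b2 := mul_le_mul (cN uS vS nS mS) T2 (norm_nonneg _) hN0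
  have b3 := mul_le_mul (cN uS vL nS mL) T3 (norm_nonneg _) hN0
  have b4 := mul_le_mul (cN uL vS nL mS) T4 (norm_nonneg _) hN0
  calc _ ≤ N * X1 + N * X2 + N * X3 + N * X3 := by
        refine (norm_add_le _ _).trans (add_le_add ((norm_add_le _ _).trans (add_le_add
          ((norm_add_le _ _).trans (add_le_add ?_ ?_)) ?_)) ?_)
        · rw [norm_mul]; exact b1
        · rw [norm_mul]; exact b2
        · rw [norm_mul]; exact b3
        · rw [norm_mul]; exact b4
    _ = N * (X1 + X2 + X3 + X3) := by ring
    _ ≤ N * ((64 * (2 * K * η + K * L * (1 / 2 - θ)) + 656 * K ^ 2 * (1 / 2 - θ)) / Λ) := by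
        refine mul_le_mul_of_nonneg_left ?_ hN0
        simp only [X1, X2, X3]
        rw [← add_div, ← add_div, ← add_div]
        apply div_le_div_of_nonneg_right _ hΛ.le
        have h1 : 0 ≤ K * (L * (1 / 2 - θ)) := mul_nonneg hK0 (mul_nonneg hL hd)
        norm_num
        nlinarith [h1]

end ZformCompare

/-! ## The `z`-forms at the actual shifts versus the main values (level of `D`) -/

section DLevel

/-- `Re β_μ⁰ = 0` for a main value `β_μ⁰ = μiα`. [cite: Zhang2022LandauSiegel, §2 (2.22)] -/
private theorem betaMain_re (μ : ℚ) (α : ℝ) : (betaMain μ α).re = 0 := by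
  simp [betaMain, Complex.mul_re]

/-- `z ↦ 𝔣(β, β_μ; zΛ)` is continuous. [folklore] -/
private theorem continuous_frakf_line (β βμ : ℂ) (Λ : ℝ) :
    Continuous fun z : ℝ => frakf β βμ (((z * Λ : ℝ)) : ℂ) := by
  unfold frakf; fun_prop

/-- `z ↦ 𝔤(β₁, β₂, β_μ; zΛ)` is continuous. [folklore] -/
private theorem continuous_frakg_line (β1 β2 βμ : ℂ) (Λ : ℝ) :
    Continuous fun z : ℝ => frakg β1 β2 βμ (((z * Λ : ℝ)) : ℂ) := by
  unfold frakg; fun_prop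

/-- The final bookkeeping inequality of `exists_S812g_sub_main_le`. [folklore] -/
private theorem final_ineq {K ηc L t d : ℝ} (hK : 0 ≤ K) (hη : 0 ≤ ηc) (hL : 0 ≤ L) (ht : 0 ≤ t)
    (hd : 0 ≤ d) :
    64 * (2 * K * (ηc * t) + K * L * d) + 656 * K ^ 2 * d ≤
      (128 * K * ηc + 64 * K * L + 656 * K ^ 2) * (t + d) := by
  have h1 : 0 ≤ K * ηc * d := by positivity
  have h2 : 0 ≤ K * L * t := by positivity
  have h3 : 0 ≤ K ^ 2 * t := by positivity
  nlinarith

set_option maxHeartbeats 400000 in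
/-- **The substitution `x = Pᶻ` with the actual shifts, quantitatively.** For `D ≥ 3` with `𝓛 ≥ 4`,
shifts `β, β₁, β₂` within `5|c′|α²𝓛` of main values `β_k⁰, β_{k₁}⁰, β_{k₂}⁰` (`0 ≤ k, k₁, k₂ ≤ 3`), and a long
exponent `θ ∈ [0.498, 1/2]`: the four-term form `S812g` (coefficients `ῑ₄, ῑ₃, ι₄, ι₃`, short exponent
`0.498`, `Λ = 𝓛⁹ = log P`) built from the actual profiles `𝔣(β,β_μ⁰;log y)`, `𝔤(β₁,β₂,β_μ⁰;log y)` at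
long exponent `θ` differs from the same form built from the main-value profiles `fX k`, `gX k₁ k₂` at long
exponent `1/2` by at most `C(c′)·(𝓛⁻⁸ + (1/2 − θ))/𝓛⁹`. (The `𝓛⁻⁸` is d19's `frakf_rpow_estimate` /
`frakg_rpow_estimate`; the `(1/2 − θ)` accounts for `log P₂ = (0.5 − 10𝓛^{−7.9})log P`.)
[cite: Zhang2022LandauSiegel, §9 p.51–52, tex L2626–L2645; §8 p.48–49, tex L2480–L2520] -/
private theorem exists_S812g_sub_main_le (c' : ℝ) : ∃ C : ℝ, 0 ≤ C ∧ ∀ (D : ℕ), 3 ≤ D → 4 ≤ ell D →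
    ∀ (β β1 β2 : ℂ) (k k1 k2 : ℚ), 0 ≤ k → k ≤ 3 → 0 ≤ k1 → k1 ≤ 3 → 0 ≤ k2 → k2 ≤ 3 →
    ‖β - betaMain k (alpha D)‖ ≤ 5 * |c'| * alpha D * ell D * alpha D →
    ‖β1 - betaMain k1 (alpha D)‖ ≤ 5 * |c'| * alpha D * ell D * alpha D →
    ‖β2 - betaMain k2 (alpha D)‖ ≤ 5 * |c'| * alpha D * ell D * alpha D →
    ∀ (θ : ℝ), 0.498 ≤ θ → θ ≤ 1 / 2 →
    ‖S812g (conj iota4) (conj iota3) iota4 iota3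
          (fun y => frakf β (betaMain (5/2) (alpha D)) (Real.log y))
          (fun y => frakf β (betaMain (3/2) (alpha D)) (Real.log y))
          (fun y => frakg β1 β2 (betaMain (5/2) (alpha D)) (Real.log y))
          (fun y => frakg β1 β2 (betaMain (3/2) (alpha D)) (Real.log y)) (ell D ^ 9) θ 0.498 -
        S812g (conj iota4) (conj iota3) iota4 iota3 (fX k (5/2) (alpha D)) (fX k (3/2) (alpha D))
          (gX k1 k2 (5/2) (alpha D)) (gX k1 k2 (3/2) (alpha D)) (ell D ^ 9) (1 / 2) 0.498‖ ≤
      C * ((ell D ^ 8)⁻¹ + (1 / 2 - θ)) / ell D ^ 9 := by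
  -- the constants (depending on `c'` only)
  obtain ⟨a, ha⟩ : ∃ a : ℝ, a = 3 + 5 * |c'| * π := ⟨_, rfl⟩
  have ha3 : 3 ≤ a := by rw [ha]; nlinarith [abs_nonneg c', Real.pi_pos]
  have ha0 : 0 ≤ a := by linarith
  obtain ⟨K, hK⟩ : ∃ K : ℝ, K = (1 + (5 / 2 + a) * π) + (1 + 2 * (a ^ 2 / (3 / 2) ^ 2) + 4 * a ^ 2 / (3 / 2) * π) :=
    ⟨_, rfl⟩
  have hKf : 1 + (5 / 2 + a) * π ≤ K := by
    rw [hK]; linarith [show 0 ≤ 1 + 2 * (a ^ 2 / (3 / 2) ^ 2) + 4 * a ^ 2 / (3 / 2) * π by positivity]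
  have hKg : 1 + 2 * (a ^ 2 / (3 / 2) ^ 2) + 4 * a ^ 2 / (3 / 2) * π ≤ K := by
    rw [hK]; linarith [show 0 ≤ (5 / 2 + a) * π by positivity]
  have hK1 : 1 ≤ K := le_trans (by linarith [show 0 ≤ (5 / 2 + a) * π by positivity]) hKf
  obtain ⟨ηc, hηc⟩ : ∃ ηc : ℝ, ηc = 5 * |c'| * π ^ 2 + (70 * |c'| * π ^ 2 + 40 * |c'| ^ 2 * π ^ 3) :=
    ⟨_, rfl⟩
  have hηc0 : 0 ≤ ηc := by rw [hηc]; positivity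
  obtain ⟨L, hL⟩ : ∃ L : ℝ, L = ((5 / 2 + a) * π + (1 + (5 / 2 + a) * π) * (5 / 2 * π)) +
      (8 / 3 * a ^ 2 * π + (1 + 4 / 9 * a ^ 2 + 8 / 3 * a ^ 2 * π) * (5 / 2 * π)) := ⟨_, rfl⟩
  have hL0 : 0 ≤ L := by rw [hL]; positivity
  have hLf : (5 / 2 + a) * π + (1 + (5 / 2 + a) * π) * (5 / 2 * π) ≤ L := by
    rw [hL]; linarith [show 0 ≤ 8 / 3 * a ^ 2 * π + (1 + 4 / 9 * a ^ 2 + 8 / 3 * a ^ 2 * π) * (5 / 2 * π) by positivity]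
  have hLg : 8 / 3 * a ^ 2 * π + (1 + 4 / 9 * a ^ 2 + 8 / 3 * a ^ 2 * π) * (5 / 2 * π) ≤ L := by
    rw [hL]; linarith [show 0 ≤ (5 / 2 + a) * π + (1 + (5 / 2 + a) * π) * (5 / 2 * π) by positivity]
  set N : ℝ := (‖conj iota4‖ + ‖conj iota3‖) * (‖iota4‖ + ‖iota3‖) with hN
  have hN0 : 0 ≤ N := by positivity
  refine ⟨N * (128 * K * ηc + 64 * K * L + 656 * K ^ 2), by positivity, ?_⟩
  intro D hD hℓ β β1 β2 k k1 k2 hk0 hk3 hk10 hk13 hk20 hk23 hβ hβ1 hβ2 θ hθ hθ'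
  -- parameters at `D`
  set α := alpha D with hαdef
  set Λ := ell D ^ 9 with hΛdef
  have hℓ1 : 1 ≤ ell D := by linarith
  have hℓ0 : 0 < ell D := by linarith
  have hΛ : 0 < Λ := by positivity
  have hα : 0 < α := Section8ShiftPerturbation.alpha_pos' hD
  have hαΛ : α * Λ = π := Section8ShiftPerturbation.alpha_mul_ell_pow_nine hD
  have hαℓ : α * ell D ≤ π := by
    rw [hαdef, Section8ShiftPerturbation.alpha_mul_ell hD]
    have h8 : 1 ≤ ell D ^ 8 := one_le_pow₀ hℓ1
    have := inv_le_one_of_one_le₀ h8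
    calc π * (ell D ^ 8)⁻¹ ≤ π * 1 := mul_le_mul_of_nonneg_left this Real.pi_pos.le
      _ = π := mul_one _
  set t : ℝ := (ell D ^ 8)⁻¹ with ht
  have ht0 : 0 ≤ t := by positivity
  have hd : 0 ≤ 1 / 2 - θ := by linarith
  -- shift sizes: `‖β‖ ≤ aα` for actual and main shifts
  have hw : 5 * |c'| * alpha D * ell D * alpha D ≤ 5 * |c'| * π * α := by
    have : 5 * |c'| * alpha D * ell D * alpha D = 5 * |c'| * (α * ell D) * α := by rw [hαdef]; ring
    rw [this]; gcongr
  have main_le : ∀ {q : ℚ}, 0 ≤ q → q ≤ 3 → ‖betaMain q α‖ ≤ a * α := by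
    intro q hq0 hq3
    refine (Section8ShiftPerturbation.norm_betaMain_le hq0 hq3 hα.le).trans ?_
    exact mul_le_mul_of_nonneg_right ha3 hα.le
  have act_le : ∀ {γ : ℂ} {q : ℚ}, 0 ≤ q → q ≤ 3 →
      ‖γ - betaMain q (alpha D)‖ ≤ 5 * |c'| * alpha D * ell D * alpha D → ‖γ‖ ≤ a * α := by
    intro γ q hq0 hq3 hγ
    have h3 : ‖betaMain q α‖ ≤ 3 * α := Section8ShiftPerturbation.norm_betaMain_le hq0 hq3 hα.le
    calc ‖γ‖ = ‖(γ - betaMain q α) + betaMain q α‖ := by rw [sub_add_cancel]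
      _ ≤ ‖γ - betaMain q α‖ + ‖betaMain q α‖ := norm_add_le _ _
      _ ≤ 5 * |c'| * π * α + 3 * α := add_le_add (hγ.trans hw) h3
      _ = a * α := by rw [ha]; ring
  have hβa : ‖β‖ ≤ a * α := act_le hk0 hk3 hβ
  have hβ1a : ‖β1‖ ≤ a * α := act_le hk10 hk13 hβ1
  have hβ2a : ‖β2‖ ≤ a * α := act_le hk20 hk23 hβ2
  have hka : ‖betaMain k α‖ ≤ a * α := main_le hk0 hk3
  have hk1a : ‖betaMain k1 α‖ ≤ a * α := main_le hk10 hk13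
  have hk2a : ‖betaMain k2 α‖ ≤ a * α := main_le hk20 hk23
  -- main-value `β_μ` facts
  have hμre : ∀ μ : ℚ, (betaMain μ α).re = 0 := fun μ => betaMain_re μ α
  have hμn : ∀ {μ : ℚ}, 0 ≤ μ → ‖betaMain μ α‖ = (μ : ℝ) * α := by
    intro μ hμ
    rw [norm_betaMain, abs_of_nonneg (by exact_mod_cast hμ), abs_of_nonneg hα.le]
  -- the generic size bounds at `L = uΛ`, `u ∈ [0,1]`
  have fbound : ∀ {γ : ℂ} {μ : ℚ}, ‖γ‖ ≤ a * α → 0 ≤ μ → (μ : ℝ) ≤ 5 / 2 → ∀ u : ℝ, 0 ≤ u → u ≤ 1 →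
      ‖frakf γ (betaMain μ α) (((u * Λ : ℝ)) : ℂ)‖ ≤ K := by
    intro γ μ hγ hμ0 hμ u hu0 hu1
    refine (norm_frakf_le_gen (hμre μ) ?_).trans hKf
    rw [hμn hμ0, abs_of_nonneg (by positivity)]
    calc ((μ : ℝ) * α + ‖γ‖) * (u * Λ) ≤ (5 / 2 * α + a * α) * (1 * Λ) := by gcongr
      _ = (5 / 2 + a) * (α * Λ) := by ring
      _ = (5 / 2 + a) * π := by rw [hαΛ]
  have gbound : ∀ {γ1 γ2 : ℂ} {μ : ℚ}, ‖γ1‖ ≤ a * α → ‖γ2‖ ≤ a * α → (3 : ℚ) / 2 ≤ μ →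
      (μ : ℝ) ≤ 5 / 2 → ∀ u : ℝ, 0 ≤ u → u ≤ 1 →
      ‖frakg γ1 γ2 (betaMain μ α) (((u * Λ : ℝ)) : ℂ)‖ ≤ K := by
    intro γ1 γ2 μ hγ1 hγ2 hμ0 hμ u hu0 hu1
    have hμ0' : 0 ≤ μ := le_trans (by norm_num) hμ0
    have hμR : (3 : ℝ) / 2 ≤ (μ : ℝ) := by
      have h := (Rat.cast_le (K := ℝ)).mpr hμ0
      push_cast at h; exact h
    have hm : 3 / 2 * α ≤ ‖betaMain μ α‖ := by
      rw [hμn hμ0']; exact mul_le_mul_of_nonneg_right hμR hα.le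
    have hma : ‖betaMain μ α‖ ≤ a * α := by
      rw [hμn hμ0']; exact mul_le_mul_of_nonneg_right (by linarith) hα.le
    have hLabs : |u * Λ| ≤ Λ := by
      rw [abs_of_nonneg (mul_nonneg hu0 hΛ.le)]; exact mul_le_of_le_one_left hΛ.le hu1
    have hm0 : (0:ℝ) < 3 / 2 * α := by positivity
    refine (norm_frakg_le_gen (β1 := γ1) (β2 := γ2) (hμre μ) hm0 hm hma hγ1 hγ2 hLabs).trans ?_
    have e1 : (a * α) ^ 2 / (3 / 2 * α) ^ 2 = a ^ 2 / (3 / 2) ^ 2 := by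
      field_simp
    have e2 : 4 * (a * α) ^ 2 / (3 / 2 * α) * Λ = 4 * a ^ 2 / (3 / 2) * (α * Λ) := by
      field_simp
    rw [e1, e2, hαΛ]
    exact hKg
  -- the approximation bounds (`η = ηc·t`)
  have fapprox : ∀ {γ : ℂ} {q : ℚ},
      ‖γ - betaMain q (alpha D)‖ ≤ 5 * |c'| * alpha D * ell D * alpha D → ∀ (μ : ℚ) (u : ℝ),
      0 ≤ u → u ≤ 1 →
      ‖frakf γ (betaMain μ α) (((u * Λ : ℝ)) : ℂ) - frakf (betaMain q α) (betaMain μ α) (((u * Λ : ℝ)) : ℂ)‖ ≤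
        ηc * t := by
    intro γ q hγ μ u hu0 hu1
    have h := Section8ShiftPerturbation.frakf_rpow_estimate c' hD hγ μ hu0 hu1
    have e : (((u * Λ : ℝ)) : ℂ) = (u : ℂ) * ((ell D ^ 9 : ℝ) : ℂ) := by rw [hΛdef]; push_cast; ring
    rw [e]
    refine h.trans ?_
    rw [ht, hηc]
    have : 0 ≤ 70 * |c'| * π ^ 2 + 40 * |c'| ^ 2 * π ^ 3 := by positivity
    exact mul_le_mul_of_nonneg_right (by linarith) (by positivity)
  have gapprox : ∀ {γ1 γ2 : ℂ} {q1 q2 : ℚ}, 0 ≤ q1 → q1 ≤ 3 → 0 ≤ q2 → q2 ≤ 3 →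
      ‖γ1 - betaMain q1 (alpha D)‖ ≤ 5 * |c'| * alpha D * ell D * alpha D →
      ‖γ2 - betaMain q2 (alpha D)‖ ≤ 5 * |c'| * alpha D * ell D * alpha D →
      ∀ {μ : ℚ}, (3:ℚ) / 2 ≤ μ → μ ≤ 3 → ∀ (u : ℝ), 0 ≤ u → u ≤ 1 →
      ‖frakg γ1 γ2 (betaMain μ α) (((u * Λ : ℝ)) : ℂ) -
          frakg (betaMain q1 α) (betaMain q2 α) (betaMain μ α) (((u * Λ : ℝ)) : ℂ)‖ ≤ ηc * t := by
    intro γ1 γ2 q1 q2 hq10 hq13 hq20 hq23 hγ1 hγ2 μ hμ0 hμ3 u hu0 hu1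
    have h := Section8ShiftPerturbation.frakg_rpow_estimate c' hD hq10 hq13 hq20 hq23 hγ1 hγ2 hμ0 hμ3 hu0 hu1
    have e : (((u * Λ : ℝ)) : ℂ) = (u : ℂ) * ((ell D ^ 9 : ℝ) : ℂ) := by rw [hΛdef]; push_cast; ring
    rw [e]
    refine h.trans ?_
    rw [ht, hηc]
    have : 0 ≤ 5 * |c'| * π ^ 2 := by positivity
    exact mul_le_mul_of_nonneg_right (by linarith) (by positivity)
  -- rewrite both forms as `Zform`s of the `z`-profiles
  have hθ0 : θ ≠ 0 := by linarith
  have hS0 : (0.498 : ℝ) ≠ 0 := by norm_num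
  have hhalf : (1 / 2 : ℝ) ≠ 0 := by norm_num
  have logexp : ∀ z : ℝ, (Real.log (rexp (Λ * z)) : ℂ) = (((z * Λ : ℝ)) : ℂ) := by
    intro z; rw [Real.log_exp, mul_comm]
  have zA := S812g_eq_zform (conj iota4) (conj iota3) iota4 iota3 hΛ hθ0 hS0
    (Fl := fun y => frakf β (betaMain (5/2) α) (Real.log y))
    (Fs := fun y => frakf β (betaMain (3/2) α) (Real.log y))
    (Gl := fun y => frakg β1 β2 (betaMain (5/2) α) (Real.log y))
    (Gs := fun y => frakg β1 β2 (betaMain (3/2) α) (Real.log y))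
    (fL := fun z => frakf β (betaMain (5/2) α) (((z * Λ : ℝ)) : ℂ))
    (fS := fun z => frakf β (betaMain (3/2) α) (((z * Λ : ℝ)) : ℂ))
    (gL := fun z => frakg β1 β2 (betaMain (5/2) α) (((z * Λ : ℝ)) : ℂ))
    (gS := fun z => frakg β1 β2 (betaMain (3/2) α) (((z * Λ : ℝ)) : ℂ))
    (fun z => by simp only [logexp]) (fun z => by simp only [logexp])
    (fun z => by simp only [logexp]) (fun z => by simp only [logexp])
  have mainexp_f : ∀ (q μ : ℚ) (z : ℝ),
      fX q μ α (rexp (Λ * z)) = frakf (betaMain q α) (betaMain μ α) (((z * Λ : ℝ)) : ℂ) := by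
    intro q μ z; rw [fX, logexp]
  have mainexp_g : ∀ (q1 q2 μ : ℚ) (z : ℝ),
      gX q1 q2 μ α (rexp (Λ * z)) = frakg (betaMain q1 α) (betaMain q2 α) (betaMain μ α) (((z * Λ : ℝ)) : ℂ) := by
    intro q1 q2 μ z; rw [gX, logexp]
  have zM := S812g_eq_zform (conj iota4) (conj iota3) iota4 iota3 hΛ hhalf hS0
    (Fl := fX k (5/2) α) (Fs := fX k (3/2) α) (Gl := gX k1 k2 (5/2) α) (Gs := gX k1 k2 (3/2) α)
    (fL := fun z => frakf (betaMain k α) (betaMain (5/2) α) (((z * Λ : ℝ)) : ℂ))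
    (fS := fun z => frakf (betaMain k α) (betaMain (3/2) α) (((z * Λ : ℝ)) : ℂ))
    (gL := fun z => frakg (betaMain k1 α) (betaMain k2 α) (betaMain (5/2) α) (((z * Λ : ℝ)) : ℂ))
    (gS := fun z => frakg (betaMain k1 α) (betaMain k2 α) (betaMain (3/2) α) (((z * Λ : ℝ)) : ℂ))
    (mainexp_f k (5/2)) (mainexp_f k (3/2)) (mainexp_g k1 k2 (5/2)) (mainexp_g k1 k2 (3/2))
  rw [zA, zM]
  -- apply the abstract comparison
  have h52 : (0:ℚ) ≤ 5/2 := by norm_num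
  have h32 : (0:ℚ) ≤ 3/2 := by norm_num
  have key := Zform_sub_Zform_le (uL := conj iota4) (uS := conj iota3) (vL := iota4) (vS := iota3)
    (f7 := fun z => frakf β (betaMain (5/2) α) (((z * Λ : ℝ)) : ℂ))
    (f6 := fun z => frakf β (betaMain (3/2) α) (((z * Λ : ℝ)) : ℂ))
    (g7 := fun z => frakg β1 β2 (betaMain (5/2) α) (((z * Λ : ℝ)) : ℂ))
    (g6 := fun z => frakg β1 β2 (betaMain (3/2) α) (((z * Λ : ℝ)) : ℂ))
    (m7 := fun z => frakf (betaMain k α) (betaMain (5/2) α) (((z * Λ : ℝ)) : ℂ))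
    (m6 := fun z => frakf (betaMain k α) (betaMain (3/2) α) (((z * Λ : ℝ)) : ℂ))
    (n7 := fun z => frakg (betaMain k1 α) (betaMain k2 α) (betaMain (5/2) α) (((z * Λ : ℝ)) : ℂ))
    (n6 := fun z => frakg (betaMain k1 α) (betaMain k2 α) (betaMain (3/2) α) (((z * Λ : ℝ)) : ℂ))
    (continuous_frakf_line _ _ _) (continuous_frakf_line _ _ _) (continuous_frakg_line _ _ _ _)
    (continuous_frakg_line _ _ _ _) (continuous_frakf_line _ _ _) (continuous_frakf_line _ _ _)
    (continuous_frakg_line _ _ _ _) (continuous_frakg_line _ _ _ _)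
    (Λ := Λ) (θ := θ) (K := K) (η := ηc * t) (L := L) hΛ hθ hθ' hK1 (by positivity) hL0
    (fun u hu0 hu1 => ⟨fbound hβa h52 (by norm_num) u hu0 hu1, fbound hβa h32 (by norm_num) u hu0 hu1,
      gbound hβ1a hβ2a (by norm_num) (by norm_num) u hu0 hu1,
      gbound hβ1a hβ2a (by norm_num) (by norm_num) u hu0 hu1⟩)
    (fun u hu0 hu1 => ⟨fbound hka h52 (by norm_num) u hu0 hu1, fbound hka h32 (by norm_num) u hu0 hu1,
      gbound hk1a hk2a (by norm_num) (by norm_num) u hu0 hu1,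
      gbound hk1a hk2a (by norm_num) (by norm_num) u hu0 hu1⟩)
    (fun u hu0 hu1 => ⟨fapprox hβ (5/2) u hu0 hu1, fapprox hβ (3/2) u hu0 hu1,
      gapprox hk10 hk13 hk20 hk23 hβ1 hβ2 (by norm_num) (by norm_num) u hu0 hu1,
      gapprox hk10 hk13 hk20 hk23 hβ1 hβ2 (by norm_num) (by norm_num) u hu0 hu1⟩)
    (fun u v hu0 hu1 hv0 hv1 => ⟨?_, ?_⟩)
  rotate_left
  · exact (frakf_lipschitz hαΛ hα hΛ ha0 hka h52 (by norm_num) hv0 hv1).trans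
      (mul_le_mul_of_nonneg_right hLf (abs_nonneg _))
  · exact (frakg_lipschitz hαΛ hα hΛ (by linarith) hk1a hk2a (by norm_num) (by norm_num) hv0 hv1).trans
      (mul_le_mul_of_nonneg_right hLg (abs_nonneg _))
  -- `Zform` is definitionally the right side of `S812g_eq_zform`
  refine (le_of_eq (by rfl)).trans (key.trans ?_)
  rw [← hN]
  have hfin := final_ineq (by linarith : (0:ℝ) ≤ K) hηc0 hL0 ht0 hd
  have h1 := div_le_div_of_nonneg_right hfin hΛ.le
  have h2 := mul_le_mul_of_nonneg_left h1 hN0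
  refine h2.trans (le_of_eq ?_)
  ring

end DLevel

/-! ## `Z22:§9.u006` INFERENCE (c-reading): `Step9u005 ⇒ Step9u006c` -/

section Assembly

variable (c' : ℝ)

/-- Eventually `log D ≥ L₀`. [cite: Zhang2022LandauSiegel, §2 p.4] -/
private theorem forAllLarge_log_ge' (L₀ : ℝ) : ForAllLarge fun D _ _ => L₀ ≤ Real.log D := by
  refine ForAllLarge.of_le ⌈Real.exp L₀⌉₊ fun D _ χ hD _ _ => ?_
  have hexp : Real.exp L₀ ≤ D := le_trans (Nat.le_ceil _) (by exact_mod_cast hD)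
  exact (Real.le_log_iff_exp_le (lt_of_lt_of_le (Real.exp_pos _) hexp)).mpr hexp

/-- Eventually `D ≥ 3`. [cite: Zhang2022LandauSiegel, §2 p.4] -/
private theorem forAllLarge_three_le : ForAllLarge fun D _ _ => 3 ≤ D :=
  ForAllLarge.of_le 3 fun _ _ _ hD _ _ => hD

/-- `log P₂ = 0.5𝓛⁹ − 10𝓛^{1.1}` and, for `𝓛 ≥ 4`, `0.498𝓛⁹ ≤ log P₂ ≤ 0.5𝓛⁹`, `10𝓛^{1.1} ≤ 10𝓛²`.
[cite: Zhang2022LandauSiegel, §2 (2.21)] -/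
private theorem log_P2_facts {D : ℕ} (h : 4 ≤ ell D) :
    Real.log (Skeleton.P2 D) = 0.5 * ell D ^ 9 - 10 * ell D ^ (1.1 : ℝ) ∧
      0.498 * ell D ^ 9 ≤ Real.log (Skeleton.P2 D) ∧ Real.log (Skeleton.P2 D) ≤ 0.5 * ell D ^ 9 ∧
      ell D ^ (1.1 : ℝ) ≤ ell D ^ 2 := by
  have h1 : 1 ≤ ell D := by linarith
  have hP : 0 < bigP D := Real.exp_pos _
  have hT : 0 < bigT D := Real.exp_pos _
  have e : Real.log (Skeleton.P2 D) = 0.5 * ell D ^ 9 - 10 * ell D ^ (1.1 : ℝ) := by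
    rw [Skeleton.P2, Real.log_div (Real.rpow_pos_of_pos hP _).ne' (pow_pos hT _).ne',
      Real.log_rpow hP, log_bigP, Real.log_pow, bigT, Real.log_exp]
    push_cast; ring
  have h2 : ell D ^ (1.1 : ℝ) ≤ ell D ^ 2 := by
    have := Real.rpow_le_rpow_of_exponent_le h1 (by norm_num : (1.1 : ℝ) ≤ 2)
    rwa [Real.rpow_two] at this
  have h0 : 0 ≤ ell D ^ (1.1 : ℝ) := Real.rpow_nonneg (by linarith) _
  have h7 : (4:ℝ) ^ 7 ≤ ell D ^ 7 := pow_le_pow_left₀ (by norm_num) h 7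
  have h3 : 10 * ell D ^ 2 ≤ 0.002 * ell D ^ 9 := by
    rw [show ell D ^ 9 = ell D ^ 2 * ell D ^ 7 by ring]
    nlinarith [pow_nonneg (by linarith : (0:ℝ) ≤ ell D) 2]
  refine ⟨e, ?_, ?_, h2⟩ <;> rw [e] <;> linarith

/-- `S812g` depends on its scale parameters only through `P^{θ_L}` and `P^{θ_S}`. [folklore] -/
private theorem S812g_congr_scales (uL uS vL vS : ℂ) (Fl Fs Gl Gs : ℝ → ℂ) {Λ θL θS Λ' θL' θS' : ℝ}
    (hL : Ppow Λ θL = Ppow Λ' θL') (hS : Ppow Λ θS = Ppow Λ' θS') :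
    S812g uL uS vL vS Fl Fs Gl Gs Λ θL θS = S812g uL uS vL vS Fl Fs Gl Gs Λ' θL' θS' := by
  unfold S812g; rw [hL, hS]

/-- `int9cov_j` as an `S812g` at scales `(Λ, θ₂, 0.498)`, `Λ = 𝓛⁹`, `θ₂ = log P₂/𝓛⁹` (for `𝓛 > 0`).
[cite: Zhang2022LandauSiegel, §9 p.51, tex L2620] -/
private theorem int9cov_eq_S812g_ell {D : ℕ} (h : 0 < ell D) (j : ℕ) :
    int9cov c' D j =
      S812g (conj iota4) (conj iota3) iota4 iota3
        (fun y => frakfW c' D j 7 y) (fun y => frakfW c' D j 6 y)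
        (fun y => frakgW c' D j 7 y) (fun y => frakgW c' D j 6 y)
        (ell D ^ 9) (Real.log (Skeleton.P2 D) / ell D ^ 9) 0.498 := by
  rw [int9cov_eq_S812g]
  have hP2 : 0 < Skeleton.P2 D := div_pos (Real.rpow_pos_of_pos (Real.exp_pos _) _) (pow_pos (Real.exp_pos _) _)
  have hP3 : 0 < P3 D := Real.rpow_pos_of_pos (Real.exp_pos _) _
  have h9 : ell D ^ 9 ≠ 0 := by positivity
  apply S812g_congr_scales
  · rw [Ppow, Ppow, one_mul, Real.exp_log hP2, mul_div_cancel₀ _ h9, Real.exp_log hP2]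
  · rw [Ppow, Ppow, one_mul, Real.exp_log hP3, P3, bigP, ← Real.exp_mul]

/-- The main-value form `S911main_j` (`j = 1,2,3`) as an `S812g` with long exponent `1/2`.
[cite: Zhang2022LandauSiegel, §9 p.51] -/
private theorem S911main_eq_S812g (α Λ : ℝ) :
    S911main1 α Λ 0.5 0.498 = S812g (conj iota4) (conj iota3) iota4 iota3
        (fX 1 (5/2) α) (fX 1 (3/2) α) (gX 2 3 (5/2) α) (gX 2 3 (3/2) α) Λ (1 / 2) 0.498 ∧
    S911main2 α Λ 0.5 0.498 = S812g (conj iota4) (conj iota3) iota4 iota3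
        (fX 2 (5/2) α) (fX 2 (3/2) α) (gX 3 1 (5/2) α) (gX 3 1 (3/2) α) Λ (1 / 2) 0.498 ∧
    S911main3 α Λ 0.5 0.498 = S812g (conj iota4) (conj iota3) iota4 iota3
        (fX 3 (5/2) α) (fX 3 (3/2) α) (gX 1 2 (5/2) α) (gX 1 2 (3/2) α) Λ (1 / 2) 0.498 := by
  have e : (0.5 : ℝ) = 1 / 2 := by norm_num
  refine ⟨?_, ?_, ?_⟩
  · rw [S911main1, S811g_eq_S812g _ _ _ _ (continuousOn_fX _ _ _) (continuousOn_fX _ _ _)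
      (continuousOn_gX _ _ _ _) (continuousOn_gX _ _ _ _), e]
  · rw [S911main2, S811g_eq_S812g _ _ _ _ (continuousOn_fX _ _ _) (continuousOn_fX _ _ _)
      (continuousOn_gX _ _ _ _) (continuousOn_gX _ _ _ _), e]
  · rw [S911main3, S811g_eq_S812g _ _ _ _ (continuousOn_fX _ _ _) (continuousOn_fX _ _ _)
      (continuousOn_gX _ _ _ _) (continuousOn_gX _ _ _ _), e]

/-- The actual profiles for `j = 1, 2, 3` in terms of `frakf/frakg` with main-value `β_μ`:
`𝔣_{j7}(y) = 𝔣(β_j, β₇⁰; log y)` etc. (`β₆ = (3/2)iα`, `β₇ = (5/2)iα` exactly).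
[cite: Zhang2022LandauSiegel, §8 Lemmas 8.2/8.4, (2.22)] -/
private theorem profiles_eq {D : ℕ} :
    ((fun y : ℝ => frakfW c' D 1 7 y) = fun y => frakf (beta1 c' D) (betaMain (5/2) (alpha D)) (Real.log y)) ∧
    ((fun y : ℝ => frakfW c' D 1 6 y) = fun y => frakf (beta1 c' D) (betaMain (3/2) (alpha D)) (Real.log y)) ∧
    ((fun y : ℝ => frakgW c' D 1 7 y) = fun y => frakg (beta2 c' D) (beta3 c' D) (betaMain (5/2) (alpha D)) (Real.log y)) ∧
    ((fun y : ℝ => frakgW c' D 1 6 y) = fun y => frakg (beta2 c' D) (beta3 c' D) (betaMain (3/2) (alpha D)) (Real.log y)) ∧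
    ((fun y : ℝ => frakfW c' D 2 7 y) = fun y => frakf (beta2 c' D) (betaMain (5/2) (alpha D)) (Real.log y)) ∧
    ((fun y : ℝ => frakfW c' D 2 6 y) = fun y => frakf (beta2 c' D) (betaMain (3/2) (alpha D)) (Real.log y)) ∧
    ((fun y : ℝ => frakgW c' D 2 7 y) = fun y => frakg (beta3 c' D) (beta1 c' D) (betaMain (5/2) (alpha D)) (Real.log y)) ∧
    ((fun y : ℝ => frakgW c' D 2 6 y) = fun y => frakg (beta3 c' D) (beta1 c' D) (betaMain (3/2) (alpha D)) (Real.log y)) ∧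
    ((fun y : ℝ => frakfW c' D 3 7 y) = fun y => frakf (beta3 c' D) (betaMain (5/2) (alpha D)) (Real.log y)) ∧
    ((fun y : ℝ => frakfW c' D 3 6 y) = fun y => frakf (beta3 c' D) (betaMain (3/2) (alpha D)) (Real.log y)) ∧
    ((fun y : ℝ => frakgW c' D 3 7 y) = fun y => frakg (beta1 c' D) (beta2 c' D) (betaMain (5/2) (alpha D)) (Real.log y)) ∧
    ((fun y : ℝ => frakgW c' D 3 6 y) = fun y => frakg (beta1 c' D) (beta2 c' D) (betaMain (3/2) (alpha D)) (Real.log y)) := by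
  have h7 : betaMu D 7 = betaMain (5/2) (alpha D) := Section8ShiftPerturbation.betaMu_seven D
  have h6 : betaMu D 6 = betaMain (3/2) (alpha D) := Section8ShiftPerturbation.betaMu_six D
  refine ⟨?_, ?_, ?_, ?_, ?_, ?_, ?_, ?_, ?_, ?_, ?_, ?_⟩ <;> funext y <;>
    simp [frakfW, frakgW, betaJ, h7, h6]

set_option maxHeartbeats 400000 in
/-- **`Z22:§9.u006` INFERENCE, second reading, DISCHARGED**: `Step9u005 c' → Step9u006c c'` —
"This yields, by substituting `x = Pᶻ`": the integral form `Z22:§9.u005` gives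
`(2α)⁻¹S₁ + 2α⁻¹S₂ + (3/(2α))S₃ = 𝔞·Theta1Coeff9 + o(1)` with (9.3), (9.4) as printed and (9.5)–(9.6)
read with the prefactor `1/((0.5)(0.498)π)` that the substitution produces (`b34c`, `b43c`). Ingredients:
the main-order identity `weighted_sum_S911_main` (tree), the shift perturbations
`𝔣_{jμ}(Pᶻ) = 𝔣𝔣_{jμ}(z) + O(𝓛⁻⁸)`, `𝔤_{jμ}(Pᶻ) = 𝔤𝔥_{jμ}(z) + O(𝓛⁻⁸)` (d19's `frakf_rpow_estimate`,
`frakg_rpow_estimate`), the scale `log P₂ = (0.5 − 10𝓛^{−7.9})log P`, and `𝔞 ≪ 𝓛⁴`, through the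
quantitative comparison `exists_S812g_sub_main_le`; total error `≪_{c′} 𝔞·𝓛⁻³ + ε → 0`.
[cite: Zhang2022LandauSiegel, §9 pp.51–52, tex L2626–L2645] -/
theorem ded9u006c_holds : Ded9u006c c' := by
  intro h5 ε hε
  obtain ⟨C, hC0, hC⟩ := exists_S812g_sub_main_le c'
  have h5' := h5 (ε / 8) (by positivity)
  -- threshold: `𝓛 ≥ M + 4` with `M·𝓛⁻¹ ≥ …`
  set M : ℝ := 2 * (1440000 * C * 11 / π) / ε with hM
  have hM0 : 0 ≤ M := by positivity
  refine ((h5'.and (forAllLarge_log_ge' (M + 4))).and forAllLarge_three_le).mono ?_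
  intro D _ χ hq hp ⟨⟨H5, HL⟩, hD3⟩ hA
  have hℓ4 : 4 ≤ ell D := by rw [ell]; linarith
  have hℓM : M ≤ ell D := by rw [ell]; linarith
  have hℓ1 : 1 ≤ ell D := by linarith
  have hℓ0 : 0 < ell D := by linarith
  set Λ : ℝ := ell D ^ 9 with hΛ
  have hΛ0 : 0 < Λ := by positivity
  set α : ℝ := alpha D with hαdef
  have hα : 0 < α := Section8ShiftPerturbation.alpha_pos' hD3
  have hαΛ : α * Λ = π := Section8ShiftPerturbation.alpha_mul_ell_pow_nine hD3
  -- the long exponent θ₂ = log P₂ / 𝓛⁹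
  obtain ⟨-, hlo, hhi, h11⟩ := log_P2_facts (D := D) hℓ4
  set θ₂ : ℝ := Real.log (Skeleton.P2 D) / Λ with hθ₂
  have hθlo : 0.498 ≤ θ₂ := by rw [hθ₂, le_div_iff₀ hΛ0]; exact hlo
  have hθhi : θ₂ ≤ 1 / 2 := by rw [hθ₂, div_le_iff₀ hΛ0]; linarith
  have hd : 1 / 2 - θ₂ ≤ 10 / ell D ^ 7 := by
    obtain ⟨e, -, -, -⟩ := log_P2_facts (D := D) hℓ4
    have : 1 / 2 - θ₂ = 10 * ell D ^ (1.1 : ℝ) / Λ := by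
      rw [hθ₂, e, hΛ]; field_simp; ring
    rw [this, hΛ, div_le_div_iff₀ hΛ0 (by positivity)]
    calc 10 * ell D ^ (1.1 : ℝ) * ell D ^ 7 ≤ 10 * ell D ^ 2 * ell D ^ 7 := by gcongr
      _ = 10 * ell D ^ 9 := by ring
  have hd0 : 0 ≤ 1 / 2 - θ₂ := by linarith
  -- the three comparisons `I_j − M_j`
  have hb1 := Section8ShiftPerturbation.norm_beta1_sub_main_le c' hD3
  have hb2 := Section8ShiftPerturbation.norm_beta2_sub_main_le c' hD3
  have hb3 := Section8ShiftPerturbation.norm_beta3_sub_main_le c' hD3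
  obtain ⟨p17, p16, q17, q16, p27, p26, q27, q26, p37, p36, q37, q36⟩ := profiles_eq c' (D := D)
  obtain ⟨m1, m2, m3⟩ := S911main_eq_S812g α Λ
  have I1 : ‖int9cov c' D 1 - S911main1 α Λ 0.5 0.498‖ ≤ C * ((ell D ^ 8)⁻¹ + (1 / 2 - θ₂)) / Λ := by
    rw [int9cov_eq_S812g_ell c' hℓ0, p17, p16, q17, q16, m1]
    exact hC D hD3 hℓ4 _ _ _ 1 2 3 (by norm_num) (by norm_num) (by norm_num) (by norm_num)
      (by norm_num) (by norm_num) hb1 hb2 hb3 θ₂ hθlo hθhi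
  have I2 : ‖int9cov c' D 2 - S911main2 α Λ 0.5 0.498‖ ≤ C * ((ell D ^ 8)⁻¹ + (1 / 2 - θ₂)) / Λ := by
    rw [int9cov_eq_S812g_ell c' hℓ0, p27, p26, q27, q26, m2]
    exact hC D hD3 hℓ4 _ _ _ 2 3 1 (by norm_num) (by norm_num) (by norm_num) (by norm_num)
      (by norm_num) (by norm_num) hb2 hb3 hb1 θ₂ hθlo hθhi
  have I3 : ‖int9cov c' D 3 - S911main3 α Λ 0.5 0.498‖ ≤ C * ((ell D ^ 8)⁻¹ + (1 / 2 - θ₂)) / Λ := by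
    rw [int9cov_eq_S812g_ell c' hℓ0, p37, p36, q37, q36, m3]
    exact hC D hD3 hℓ4 _ _ _ 3 1 2 (by norm_num) (by norm_num) (by norm_num) (by norm_num)
      (by norm_num) (by norm_num) hb3 hb1 hb2 θ₂ hθlo hθhi
  -- sizes
  have hR : C * ((ell D ^ 8)⁻¹ + (1 / 2 - θ₂)) / Λ ≤ 11 * C / (ell D ^ 7 * Λ) := by
    have h8 : (ell D ^ 8)⁻¹ ≤ 1 / ell D ^ 7 := by
      rw [inv_eq_one_div]
      exact one_div_le_one_div_of_le (by positivity) (pow_le_pow_right₀ hℓ1 (by norm_num))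
    have : (ell D ^ 8)⁻¹ + (1 / 2 - θ₂) ≤ 11 / ell D ^ 7 := by
      calc (ell D ^ 8)⁻¹ + (1 / 2 - θ₂) ≤ 1 / ell D ^ 7 + 10 / ell D ^ 7 := add_le_add h8 hd
        _ = 11 / ell D ^ 7 := by ring
    calc C * ((ell D ^ 8)⁻¹ + (1 / 2 - θ₂)) / Λ ≤ C * (11 / ell D ^ 7) / Λ := by gcongr
      _ = 11 * C / (ell D ^ 7 * Λ) := by field_simp
  have hAfrak : frakA χ ≤ 360000 * ell D ^ 4 := by
    have := frakA_le_log_pow_four χ (by rw [← ell]; linarith) hp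
    rwa [← ell] at this
  have hA0 : 0 ≤ frakA χ := frakA_nonneg χ
  -- the exact main-order identity
  have hmain : 1 / (2 * (α : ℂ)) * S911main1 α Λ 0.5 0.498 + 2 / (α : ℂ) * S911main2 α Λ 0.5 0.498
      + 3 / (2 * (α : ℂ)) * S911main3 α Λ 0.5 0.498 = Theta1Coeff9 := by
    rw [weighted_sum_S911_main hα hΛ0 hαΛ]; rfl
  -- decomposition of `wsum9 − 𝔞·Theta1Coeff9`
  set S1 := Sj c' D 1 (a12 χ) (a22 χ)
  set S2 := Sj c' D 2 (a12 χ) (a22 χ)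
  set S3 := Sj c' D 3 (a12 χ) (a22 χ)
  set J1 := int9cov c' D 1
  set J2 := int9cov c' D 2
  set J3 := int9cov c' D 3
  set N1 := S911main1 α Λ 0.5 0.498
  set N2 := S911main2 α Λ 0.5 0.498
  set N3 := S911main3 α Λ 0.5 0.498
  have e : wsum9 c' χ - (frakA χ : ℂ) * Theta1Coeff9 =
      (1 / (2 * (α : ℂ)) * (S1 - (frakA χ : ℂ) * J1) + 2 / (α : ℂ) * (S2 - (frakA χ : ℂ) * J2) +
        3 / (2 * (α : ℂ)) * (S3 - (frakA χ : ℂ) * J3)) +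
      (frakA χ : ℂ) * (1 / (2 * (α : ℂ)) * (J1 - N1) + 2 / (α : ℂ) * (J2 - N2) +
        3 / (2 * (α : ℂ)) * (J3 - N3)) := by
    rw [← hmain, wsum9]; ring
  rw [e]
  -- norms of the weights
  have hαC : ‖(α : ℂ)‖ = α := by rw [Complex.norm_real, Real.norm_eq_abs, abs_of_pos hα]
  have w1 : ‖1 / (2 * (α : ℂ))‖ = 1 / (2 * α) := by
    rw [norm_div, norm_one, norm_mul, Complex.norm_two, hαC]
  have w2 : ‖2 / (α : ℂ)‖ = 2 / α := by rw [norm_div, Complex.norm_two, hαC]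
  have w3 : ‖3 / (2 * (α : ℂ))‖ = 3 / (2 * α) := by
    rw [norm_div, norm_mul, Complex.norm_two, hαC]; norm_num
  have hS1 := H5 hA 1 (by simp)
  have hS2 := H5 hA 2 (by simp)
  have hS3 := H5 hA 3 (by simp)
  -- first block ≤ 4 · (ε/8) · α / α = ε/2
  have blk1 : ‖1 / (2 * (α : ℂ)) * (S1 - (frakA χ : ℂ) * J1) + 2 / (α : ℂ) * (S2 - (frakA χ : ℂ) * J2) +
      3 / (2 * (α : ℂ)) * (S3 - (frakA χ : ℂ) * J3)‖ ≤ ε / 2 := by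
    calc _ ≤ ‖1 / (2 * (α : ℂ)) * (S1 - (frakA χ : ℂ) * J1)‖ + ‖2 / (α : ℂ) * (S2 - (frakA χ : ℂ) * J2)‖ +
          ‖3 / (2 * (α : ℂ)) * (S3 - (frakA χ : ℂ) * J3)‖ :=
          (norm_add_le _ _).trans (add_le_add (norm_add_le _ _) le_rfl)
      _ ≤ 1 / (2 * α) * (ε / 8 * α) + 2 / α * (ε / 8 * α) + 3 / (2 * α) * (ε / 8 * α) := by
          rw [norm_mul, norm_mul, norm_mul, w1, w2, w3]
          gcongr
      _ = ε / 2 := by field_simp; ring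
  -- second block ≤ 𝔞 · (4/α) · 11C/(𝓛⁷Λ) = 𝔞 · 44C/(π𝓛⁷) ≤ 360000·44C·𝓛⁻³/π ≤ ε/2
  have hJN : ∀ {J N : ℂ}, ‖J - N‖ ≤ C * ((ell D ^ 8)⁻¹ + (1 / 2 - θ₂)) / Λ →
      ‖J - N‖ ≤ 11 * C / (ell D ^ 7 * Λ) := fun h => h.trans hR
  have blk2 : ‖(frakA χ : ℂ) * (1 / (2 * (α : ℂ)) * (J1 - N1) + 2 / (α : ℂ) * (J2 - N2) +
      3 / (2 * (α : ℂ)) * (J3 - N3))‖ ≤ ε / 2 := by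
    rw [norm_mul, Complex.norm_real, Real.norm_eq_abs, abs_of_nonneg hA0]
    have inner : ‖1 / (2 * (α : ℂ)) * (J1 - N1) + 2 / (α : ℂ) * (J2 - N2) + 3 / (2 * (α : ℂ)) * (J3 - N3)‖ ≤
        4 / α * (11 * C / (ell D ^ 7 * Λ)) := by
      calc _ ≤ ‖1 / (2 * (α : ℂ)) * (J1 - N1)‖ + ‖2 / (α : ℂ) * (J2 - N2)‖ + ‖3 / (2 * (α : ℂ)) * (J3 - N3)‖ :=
            (norm_add_le _ _).trans (add_le_add (norm_add_le _ _) le_rfl)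
        _ ≤ 1 / (2 * α) * (11 * C / (ell D ^ 7 * Λ)) + 2 / α * (11 * C / (ell D ^ 7 * Λ)) +
            3 / (2 * α) * (11 * C / (ell D ^ 7 * Λ)) := by
            rw [norm_mul, norm_mul, norm_mul, w1, w2, w3]
            gcongr
            · exact hJN I1
            · exact hJN I2
            · exact hJN I3
        _ = 4 / α * (11 * C / (ell D ^ 7 * Λ)) := by ring
    have step : frakA χ * (4 / α * (11 * C / (ell D ^ 7 * Λ))) ≤
        360000 * ell D ^ 4 * (4 / α * (11 * C / (ell D ^ 7 * Λ))) :=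
      mul_le_mul_of_nonneg_right hAfrak (by positivity)
    have eval : 360000 * ell D ^ 4 * (4 / α * (11 * C / (ell D ^ 7 * Λ))) =
        (1440000 * C * 11 / π) / ell D ^ 3 := by
      have hπ : π = α * Λ := hαΛ.symm
      rw [hπ, hΛ]; field_simp; ring
    have fin : (1440000 * C * 11 / π) / ell D ^ 3 ≤ ε / 2 := by
      rw [div_le_iff₀ (by positivity)]
      have hℓ3 : ell D ≤ ell D ^ 3 := le_self_pow₀ hℓ1 (by norm_num)
      have hM' : M * (ε / 2) = 1440000 * C * 11 / π := by rw [hM]; field_simp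
      rw [← hM']
      have := mul_le_mul_of_nonneg_right (hℓM.trans hℓ3) (by positivity : 0 ≤ ε / 2)
      linarith
    calc frakA χ * ‖1 / (2 * (α : ℂ)) * (J1 - N1) + 2 / (α : ℂ) * (J2 - N2) + 3 / (2 * (α : ℂ)) * (J3 - N3)‖
        ≤ frakA χ * (4 / α * (11 * C / (ell D ^ 7 * Λ))) := mul_le_mul_of_nonneg_left inner hA0
      _ ≤ ε / 2 := by rw [eval] at step; exact step.trans fin
  calc _ ≤ ‖1 / (2 * (α : ℂ)) * (S1 - (frakA χ : ℂ) * J1) + 2 / (α : ℂ) * (S2 - (frakA χ : ℂ) * J2) +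
        3 / (2 * (α : ℂ)) * (S3 - (frakA χ : ℂ) * J3)‖ +
        ‖(frakA χ : ℂ) * (1 / (2 * (α : ℂ)) * (J1 - N1) + 2 / (α : ℂ) * (J2 - N2) +
          3 / (2 * (α : ℂ)) * (J3 - N3))‖ := norm_add_le _ _
    _ ≤ ε / 2 + ε / 2 := add_le_add blk1 blk2
    _ = ε := by ring

/-- `Ded9u006c` — `_holds` alias of `ded9u006c_holds` above under the fact's exact name (appended
2026-08-28, D-0026 bookkeeping: the proof term is the existing theorem of this file; no statement,
definition or attribute is edited; no new named fact; the ledger's debt table listed the fact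
unproved). [cite: Zhang2022LandauSiegel, §9 pp.51–52, tex L2626–L2645] -/
theorem _root_.Literature.NumberTheory.LFunctions.Zhang2022.Section9Statements.Ded9u006c_holds :
    Ded9u006c c' :=
  _root_.Literature.NumberTheory.LFunctions.Zhang2022.Section9Discharge.ded9u006c_holds (c' := c')


/-- **The c-reading of (9.7) modulo the single display `Z22:§9.u004`.** From (9.1), Proposition 7.1 and
the integral form `Step9u004r` ("in a way similar to the proof of (8.12)"), the kernel derives
`Ξ₁₂ = 𝔠₂ᶜ𝔞𝔓 + o(𝔓)` (`Eval97c`, `𝔠₂ᶜ = frakc2c`): `Step9u004r ⇒ Step9u005` (`ded9u005_holds`) `⇒ Step9u006c`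
(`ded9u006c_holds`) `⇒ Step9u007c` (`step9u007c_of`, with Prop. 7.1) `⇒ Eval97c` (`ded97lastc_holds`, with
(9.1)). [cite: Zhang2022LandauSiegel, §9 pp.51–52, tex L2586–L2669] -/
theorem eval97c_of_step9u004r (h91 : Skeleton.Eq91 c') (h71 : Skeleton.Prop71 c')
    (h4 : Step9u004r c') : Eval97c c' := by
  have h5 : Step9u005 c' := ded9u005_holds c' h4
  have h6 : Step9u006c c' := ded9u006c_holds c' h5
  have h7 : Step9u007c c' := step9u007c_of c' h71 h5 h6
  exact ded97lastc_holds c' h91 h7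

/-- **`Skeleton.Ded97` in the c-reading, modulo the one typed inference `Ded9u004` and the exact
expansion `Step9u001`:** `Step9u001 → Ded9u004 → (Eq91 → Prop71 → Lemma82 → Lemma84 → Eval97c)` — every
other step of §9 is kernel-proved (`ded9u002_holds`, `ded9u003_holds`, `ded9u005_holds`,
`ded9u006c_holds`, `step9u007c_of`, `ded97lastc_holds`); Lemma 8.3 is not used on this path (it enters only
the proof of Lemma 8.4). [cite: Zhang2022LandauSiegel, §9 pp.51–52] -/
theorem eval97c_of_ded9u004 (h1 : Step9u001 c') (hD4 : Ded9u004 c') (h91 : Skeleton.Eq91 c')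
    (h71 : Skeleton.Prop71 c') (h82 : Skeleton.Lemma82 c') (h84 : Skeleton.Lemma84 c') :
    Eval97c c' :=
  eval97c_of_step9u004r c' h91 h71
    (hD4 h1 (ded9u002_holds c' h82) (ded9u003_holds c' h84) h82 h84)

end Assembly

end Literature.NumberTheory.LFunctions.Zhang2022.Section9Discharge

end
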